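import Literature.Analysis.FluidPDE.PineauVicolWeightPositivity
import Literature.Analysis.FluidPDE.ParabolicHarnackDriftGapProofs
import Literature.Analysis.FluidPDE.ParabolicWeakHarnackProofs
import HarnessLib

/-!
# Harnack chains, barriers and the Gaussian bounds (5.3) (Pineau–Vicol 2026, Prop. 5.1′)

Analysis/FluidPDE support file (all results proved; no named facts), last of four files
realising the positive weight of **Proposition 5.1** of B. Pineau, V. Vicol, arXiv:2607.09619
(2026), p. 12: *for `U` smooth, divergence-free with (1.9), (2.1) and `ε ∈ (0,1)` there are
`m, M > 0` depending on `ε, C_{U,0}` and a positive `C²` weight `w` with `L*w = 0` and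
`m e^{−(1+ε)|y|²/4} ≤ w(y) ≤ M e^{−(1−ε)|y|²/4}`.* Main result: **`DriftHyp.exists_weight`**
(on `ℝ^{n+1}`, for `ε ∈ (½, 1)`, weight normalised by `v(0) = 1`, explicit constants
`weightLowerConst`, `weightUpperConst` depending only on `ε`, `C₀`, `n`).

* **Harnack** for positive solutions of `Δw + Dw[β] + c₀w = 0` at scale `λ` with `λ|β| ≤ 1`
  (`harnack_of_solution`, from the tree's Lieberman parabolic Harnack inequality
  `Lieberman1996_harnack_drift_gap_of_weak_harnack` applied to static solutions), Harnack chains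
  (`harnack_chain`) and the mean-value bound (`harnack_mean`);
* a **weak maximum principle** on bounded open sets for `−Δφ − Dφ[b] + Vφ ≤ 0`, `V ≥ 0`
  (`weak_maximum_principle`, barrier `e^{θ⟪e,·⟫}`);
* the barrier identities (5.6) (`barrier_equation`, for `φ_ε = v e^{−ε|y|²/4}`) and (5.9)
  (`barrier_gaussian`);
* the a priori decay of `φ_ε` for `ε > ½` from `v ∈ L²(γ)` (`DriftHyp.decay`) — the whole-space
  substitute for the Dirichlet condition of the source's Lemma 5.4 — and the **upper** and
  **lower Gaussian bounds** (`DriftHyp.upper_bound`, `DriftHyp.lower_bound`) by comparison on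
  annuli, exactly as in Lemmas 5.4–5.6 of the source.

## References

* B. Pineau, V. Vicol, arXiv:2607.09619 (2026), Prop. 5.1, (5.3), Lemmas 5.4–5.6, (5.6)–(5.10).
  [PineauVicol2026]
* G. M. Lieberman, *Second order parabolic differential equations* (1996), Harnack inequality.
  [Lieberman1996]
-/

noncomputable section

open MeasureTheory TopologicalSpace Set Function Filter Topology InnerProductSpace Real
open scoped RealInnerProductSpace ENNReal NNReal ContDiff Distributions

/-! ## F6: Harnack's inequality for positive solutions and the Gaussian bounds -/

namespace Literature.Analysis.FluidPDE

namespace PineauVicol2026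

open scoped Laplacian

variable {E : Type} [NormedAddCommGroup E] [InnerProductSpace ℝ E] [FiniteDimensional ℝ E]
  [MeasurableSpace E] [BorelSpace E]

/-! ### Affine rescaling of a function -/

omit [FiniteDimensional ℝ E] [MeasurableSpace E] [BorelSpace E] in
/-- `D(w(y + λ·))(x) = λ Dw(y + λx)`. [folklore] -/
theorem fderiv_comp_affine {F : Type*} [NormedAddCommGroup F] [NormedSpace ℝ F] {w : E → F}
    (hw : Differentiable ℝ w) (y : E) (lam : ℝ) (x : E) :
    fderiv ℝ (fun z => w (y + lam • z)) x = lam • fderiv ℝ w (y + lam • x) := by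
  have hA : HasFDerivAt (fun z : E => y + lam • z) (lam • ContinuousLinearMap.id ℝ E) x := by
    simpa using ((hasFDerivAt_id x).const_smul lam).const_add y
  rw [show (fun z => w (y + lam • z)) = w ∘ (fun z : E => y + lam • z) from rfl,
    ((hw (y + lam • x)).hasFDerivAt.comp x hA).fderiv]
  ext v
  simp

omit [MeasurableSpace E] [BorelSpace E] in
/-- `Δ(w(y + λ·))(x) = λ² Δw(y + λx)` for `C²` functions. [folklore] -/
theorem laplacian_comp_affine {w : E → ℝ} (hw : ContDiff ℝ 2 w) (y : E) (lam : ℝ) (x : E) :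
    (Δ (fun z => w (y + lam • z))) x = lam ^ 2 * (Δ w) (y + lam • x) := by
  set b := stdOrthonormalBasis ℝ E with hb
  have hwd : Differentiable ℝ w := hw.differentiable (by norm_num)
  have hcomp : ContDiff ℝ 2 (fun z => w (y + lam • z)) :=
    hw.comp (contDiff_const.add (contDiff_id.const_smul lam))
  rw [laplacian_eq_sum_fderiv_fderiv b hcomp x, laplacian_eq_sum_fderiv_fderiv b hw (y + lam • x), Finset.mul_sum]
  refine Finset.sum_congr rfl fun i _ => ?_
  have hgi : Differentiable ℝ (fun z => fderiv ℝ w z (b i)) :=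
    ((hw.fderiv_right (m := 1) le_rfl).clm_apply contDiff_const).differentiable one_ne_zero
  have h1 : (fun z => fderiv ℝ (fun z => w (y + lam • z)) z (b i)) = fun z => lam * fderiv ℝ w (y + lam • z) (b i) := by
    funext z
    rw [fderiv_comp_affine hwd y lam z]
    simp [smul_eq_mul]
  rw [h1]
  have hd : DifferentiableAt ℝ (fun z => fderiv ℝ w (y + lam • z) (b i)) x :=
    (hgi (y + lam • x)).comp x ((differentiableAt_const y).add (differentiableAt_id.const_smul lam))
  rw [fderiv_const_mul hd]
  simp only [FunLike.coe_smul, Pi.smul_apply, smul_eq_mul]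
  have h2 := fderiv_comp_affine (w := fun z => fderiv ℝ w z (b i)) hgi y lam x
  rw [h2]
  simp only [FunLike.coe_smul, Pi.smul_apply, smul_eq_mul]
  ring

/-! ### The Harnack constant of the tree's parabolic Harnack inequality -/

variable (E) in
/-- A Harnack constant for `uₜ + a·∇u − Δu = 0` with drift bound `1` and radii `≤ 2` (Lieberman
1996, Thm. 6.27, the tree's proved `Lieberman1996_harnack_drift_gap`). [cite: Lieberman1996, Ch. VI Thm 6.27] -/
def harnackConst : ℝ :=
  Classical.choose (Lieberman1996_harnack_drift_gap_of_weak_harnack E (Lieberman1996_weak_harnack_holds E)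
    (A := 1) (R₀ := 2) two_pos)

/-- The Harnack constant is positive. [folklore] -/
theorem harnackConst_pos : 0 < harnackConst E :=
  (Classical.choose_spec (Lieberman1996_harnack_drift_gap_of_weak_harnack E (Lieberman1996_weak_harnack_holds E)
    (A := 1) (R₀ := 2) two_pos)).1

/-- **Elliptic Harnack inequality at scale `λ`** for positive smooth solutions of
`Δw + Dw[β] + c₀ w = 0` (`c₀ ≥ 0`): if `λ‖β‖ ≤ 1` on `B(y, 9λ)` then
`w(x₁) ≤ C_H w(x₂)` for `x₁ ∈ B(y, λ)`, `x₂ ∈ B(y, 2λ)` — the stationary lift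
`u(t, x) = e^{−λ²c₀t} w(y + λx)` is a positive solution of `uₜ − Δu + ã·∇u = 0`,
`ã(x) = −λβ(y + λx)`, in the class of the tree's parabolic Harnack inequality (Lieberman 1996,
Thm. 6.27; this is the Harnack inequality "[27, Corollary 9.25]" of Pineau–Vicol's Lemmas 5.4, 5.6).
[cite: PineauVicol2026, proof of Lemma 5.4 (Harnack, [27, Cor. 9.25])] -/
theorem harnack_of_solution {w : E → ℝ} (hw : ContDiff ℝ ∞ w) (hwpos : ∀ x, 0 < w x) {β : E → E}
    (hβ : Continuous β) {c₀ : ℝ} (hc₀ : 0 ≤ c₀)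
    (heq : ∀ x, (Δ w) x + fderiv ℝ w x (β x) + c₀ * w x = 0)
    {y : E} {lam : ℝ} (hlam : 0 < lam) (hbd : ∀ x ∈ Metric.ball y (9 * lam), lam * ‖β x‖ ≤ 1)
    {x₁ x₂ : E} (hx₁ : x₁ ∈ Metric.ball y lam) (hx₂ : x₂ ∈ Metric.ball y (2 * lam)) :
    w x₁ ≤ harnackConst E * w x₂ := by
  obtain ⟨hCpos, hC⟩ := Classical.choose_spec (Lieberman1996_harnack_drift_gap_of_weak_harnack E
    (Lieberman1996_weak_harnack_holds E) (A := 1) (R₀ := 2) two_pos)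
  set C := harnackConst E with hCdef
  have hCeq : Classical.choose (Lieberman1996_harnack_drift_gap_of_weak_harnack E (Lieberman1996_weak_harnack_holds E)
    (A := 1) (R₀ := 2) two_pos) = C := rfl
  rw [hCeq] at hC
  -- the rescaled stationary solution and its lift
  set κ : ℝ := -(lam ^ 2 * c₀) with hκ
  set W : E → ℝ := fun z => w (y + lam • z) with hW
  set u : ℝ → E → ℝ := fun t z => Real.exp (κ * t) * W z with hu
  set a : ℝ → E → E := fun _ z => -(lam • β (y + lam • z)) with ha
  have hw2 : ContDiff ℝ 2 w := hw.of_le (by norm_cast)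
  have hwd : Differentiable ℝ w := hw.differentiable (by simp)
  have hWs : ContDiff ℝ ∞ W := hw.comp (contDiff_const.add (contDiff_id.const_smul lam))
  have hW2 : ContDiff ℝ 2 W := hWs.of_le (by norm_cast)
  -- derivatives of `u t`
  have hDu : ∀ t z, fderiv ℝ (u t) z = Real.exp (κ * t) • fderiv ℝ W z := by
    intro t z
    simp only [hu]
    exact fderiv_const_mul ((hWs.differentiable (by simp)) z) _
  have hΔu : ∀ t z, (Δ (u t)) z = Real.exp (κ * t) * (Δ W) z := by
    intro t z
    have e : u t = Real.exp (κ * t) • W := by funext z'; simp [hu]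
    rw [e, InnerProductSpace.laplacian_smul _ (hW2.contDiffAt), smul_eq_mul]
  have hΔW : ∀ z, (Δ W) z = lam ^ 2 * (Δ w) (y + lam • z) := fun z => laplacian_comp_affine hw2 y lam z
  have hDW : ∀ z, fderiv ℝ W z = lam • fderiv ℝ w (y + lam • z) := fun z => fderiv_comp_affine hwd y lam z
  -- the pointwise identity `Δ(u r) z − D(u r) z (a r z) = κ u r z`
  have hpt : ∀ r z, (Δ (u r)) z - fderiv ℝ (u r) z (a r z) = κ * u r z := by
    intro r z
    rw [hΔu, hDu, hΔW, hDW]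
    simp only [ha, FunLike.coe_smul, Pi.smul_apply, smul_eq_mul, map_neg, map_smul, hu, hW, hκ]
    have := heq (y + lam • z)
    linear_combination Real.exp (-(lam ^ 2 * c₀) * r) * lam ^ 2 * this
  -- the time derivative of `u`
  have hdt : ∀ z r, HasDerivAt (fun t => u t z) (κ * u r z) r := by
    intro z r
    simp only [hu]
    have h1 : HasDerivAt (fun t => Real.exp (κ * t)) (Real.exp (κ * r) * κ) r := by
      have := ((hasDerivAt_id r).const_mul κ).exp
      simpa [mul_comm] using this
    have h2 := h1.mul_const (W z)
    rw [show κ * u r z = Real.exp (κ * r) * κ * W z by simp only [hu]; ring]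
    exact h2
  -- apply the parabolic Harnack inequality
  have hΩ : IsOpen (Metric.ball (0 : E) 9) := Metric.isOpen_ball
  have hameas : Measurable (Function.uncurry a) := by
    have : Continuous (Function.uncurry a) := by
      simp only [ha]
      exact ((hβ.comp (continuous_const.add (continuous_snd.const_smul lam))).const_smul lam).neg
    exact this.measurable
  have habd : ∀ t ∈ Set.Ioc (0 : ℝ) 65, ∀ z ∈ Metric.ball (0 : E) 9, ‖a t z‖ ≤ 1 := by
    intro t _ z hz
    simp only [ha, norm_neg, norm_smul, Real.norm_eq_abs, abs_of_pos hlam]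
    refine hbd (y + lam • z) ?_
    rw [Metric.mem_ball, dist_eq_norm, add_sub_cancel_left, norm_smul, Real.norm_eq_abs, abs_of_pos hlam]
    rw [Metric.mem_ball, dist_zero_right] at hz
    nlinarith
  have hu2 : ∀ t ∈ Set.Ioc (0 : ℝ) 65, ContDiffOn ℝ 2 (u t) (Metric.ball (0 : E) 9) := fun t _ =>
    (contDiff_const.mul hW2).contDiffOn
  have hDuc : ContinuousOn (fun p : ℝ × E => fderiv ℝ (u p.1) p.2) (Set.Ioc (0 : ℝ) 65 ×ˢ Metric.ball (0 : E) 9) := by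
    have : Continuous fun p : ℝ × E => fderiv ℝ (u p.1) p.2 := by
      have e : (fun p : ℝ × E => fderiv ℝ (u p.1) p.2) = fun p => Real.exp (κ * p.1) • fderiv ℝ W p.2 := by
        funext p; exact hDu p.1 p.2
      rw [e]
      exact ((Real.continuous_exp.comp (continuous_const.mul continuous_fst)).smul
        ((hWs.continuous_fderiv (by simp)).comp continuous_snd))
    exact this.continuousOn
  have hΔuc : ContinuousOn (fun p : ℝ × E => (Δ (u p.1)) p.2) (Set.Ioc (0 : ℝ) 65 ×ˢ Metric.ball (0 : E) 9) := by
    have : Continuous fun p : ℝ × E => (Δ (u p.1)) p.2 := by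
      have e : (fun p : ℝ × E => (Δ (u p.1)) p.2) = fun p => Real.exp (κ * p.1) * (Δ W) p.2 := by
        funext p; exact hΔu p.1 p.2
      rw [e]
      exact (Real.continuous_exp.comp (continuous_const.mul continuous_fst)).mul
        ((continuous_laplacian hW2).comp continuous_snd)
    exact this.continuousOn
  have hint : ∀ z ∈ Metric.ball (0 : E) 9, ∀ s' t : ℝ, 0 < s' → s' ≤ t → t ≤ 65 →
      u t z - u s' z = ∫ r in s'..t, ((Δ (u r)) z - fderiv ℝ (u r) z (a r z)) := by
    intro z _ s' t _ hst _
    simp_rw [hpt]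
    rw [intervalIntegral.integral_eq_sub_of_hasDerivAt (fun r _ => hdt z r)]
    exact ((continuous_const.mul ((Real.continuous_exp.comp (continuous_const.mul continuous_id)).mul
      continuous_const)).intervalIntegrable _ _)
  have hball : Metric.closedBall (0 : E) (4 * 2) ⊆ Metric.ball (0 : E) 9 :=
    Metric.closedBall_subset_ball (by norm_num)
  have hpos : ∀ t ∈ Set.Ioo ((65 : ℝ) - 16 * 2 ^ 2) 65, ∀ z ∈ Metric.ball (0 : E) (4 * 2), 0 ≤ u t z :=
    fun t _ z _ => by simp only [hu]; exact (mul_pos (Real.exp_pos _) (hwpos _)).le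
  -- the points
  set z₁ : E := lam⁻¹ • (x₁ - y) with hz₁
  set z₂ : E := lam⁻¹ • (x₂ - y) with hz₂
  have hyz₁ : y + lam • z₁ = x₁ := by rw [hz₁, smul_smul, mul_inv_cancel₀ hlam.ne', one_smul]; abel
  have hyz₂ : y + lam • z₂ = x₂ := by rw [hz₂, smul_smul, mul_inv_cancel₀ hlam.ne', one_smul]; abel
  have hz₁b : z₁ ∈ Metric.ball (0 : E) (2 / 2) := by
    rw [Metric.mem_ball, dist_zero_right, hz₁, norm_smul, norm_inv, Real.norm_eq_abs, abs_of_pos hlam]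
    rw [Metric.mem_ball, dist_eq_norm] at hx₁
    rw [inv_mul_lt_iff₀ hlam]; linarith
  have hz₂b : z₂ ∈ Metric.ball (0 : E) 2 := by
    rw [Metric.mem_ball, dist_zero_right, hz₂, norm_smul, norm_inv, Real.norm_eq_abs, abs_of_pos hlam]
    rw [Metric.mem_ball, dist_eq_norm] at hx₂
    rw [inv_mul_lt_iff₀ hlam]; linarith
  have ht₁ : (97 / 2 : ℝ) ∈ Set.Ioo ((65 : ℝ) - 17 / 4 * 2 ^ 2) (65 - 4 * 2 ^ 2) := by norm_num
  have ht₂ : (63 : ℝ) ∈ Set.Ioo ((65 : ℝ) - 2 ^ 2) 65 := by norm_num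
  have key := hC hΩ hameas habd hu2 hDuc hΔuc hint two_pos le_rfl hball (by norm_num) le_rfl hpos ht₁ hz₁b ht₂ hz₂b
  -- unwind
  simp only [hu, hW] at key
  rw [hyz₁, hyz₂] at key
  have hκ0 : κ ≤ 0 := by rw [hκ]; exact neg_nonpos.2 (by positivity)
  have hexp : Real.exp (κ * 63) ≤ Real.exp (κ * (97 / 2)) := Real.exp_le_exp.2 (by nlinarith)
  have hw2' := hwpos x₂
  have hC0 := hCpos.le
  -- `e^{κ t₁} w x₁ ≤ C e^{κ t₂} w x₂ ≤ C e^{κ t₁} w x₂`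
  have h1 : Real.exp (κ * (97 / 2)) * w x₁ ≤ Real.exp (κ * (97 / 2)) * (C * w x₂) := by
    calc Real.exp (κ * (97 / 2)) * w x₁ ≤ C * (Real.exp (κ * 63) * w x₂) := key
      _ ≤ C * (Real.exp (κ * (97 / 2)) * w x₂) :=
          mul_le_mul_of_nonneg_left (mul_le_mul_of_nonneg_right hexp hw2'.le) hC0
      _ = Real.exp (κ * (97 / 2)) * (C * w x₂) := by ring
  exact le_of_mul_le_mul_left h1 (Real.exp_pos _)

/-! ### The weak maximum principle on bounded open sets -/

omit [MeasurableSpace E] [BorelSpace E] in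
/-- The exponential barrier `h(x) = e^{θ⟪e, x⟫}`: `∇h = θ h e`, `Δh = θ² h` for `‖e‖ = 1`. [folklore] -/
theorem expInner_calculus {e : E} (he : ‖e‖ = 1) (θ : ℝ) (x : E) :
    gradient (fun z : E => Real.exp (θ * ⟪e, z⟫)) x = (θ * Real.exp (θ * ⟪e, x⟫)) • e ∧
      (Δ (fun z : E => Real.exp (θ * ⟪e, z⟫))) x = θ ^ 2 * Real.exp (θ * ⟪e, x⟫) := by
  haveI : CompleteSpace E := FiniteDimensional.complete ℝ E
  have hℓeq : (fun z : E => ⟪e, z⟫) = (innerSL ℝ e : E →L[ℝ] ℝ) := by funext z; simp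
  have hℓ : ContDiff ℝ 2 (fun z : E => ⟪e, z⟫) := by rw [hℓeq]; exact (innerSL ℝ e).contDiff
  have hψ : ContDiff ℝ 2 (fun t : ℝ => Real.exp (θ * t)) := Real.contDiff_exp.comp (contDiff_const.mul contDiff_id)
  have hDℓ : ∀ y, fderiv ℝ (fun z : E => ⟪e, z⟫) y = innerSL ℝ e := fun y => by
    rw [hℓeq]; exact (innerSL ℝ e).fderiv
  have hgrad : gradient (fun z : E => ⟪e, z⟫) x = e := by
    apply ext_inner_right ℝ
    intro v
    rw [inner_gradient_left, hDℓ, innerSL_apply_apply]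
  have hlapℓ : (Δ (fun z : E => ⟪e, z⟫)) x = 0 := by
    rw [laplacian_eq_sum_fderiv_fderiv (stdOrthonormalBasis ℝ E) hℓ]
    refine Finset.sum_eq_zero fun i _ => ?_
    simp only [hDℓ, innerSL_apply_apply, fderiv_fun_const, Pi.zero_apply, zero_apply]
  have hd1 : deriv (fun t : ℝ => Real.exp (θ * t)) = fun t => θ * Real.exp (θ * t) :=
    funext fun t => by
      rw [((hasDerivAt_id' t).const_mul θ).exp.deriv, mul_one, mul_comm]
  have hd2 : deriv (deriv (fun t : ℝ => Real.exp (θ * t))) = fun t => θ ^ 2 * Real.exp (θ * t) := by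
    rw [hd1]
    funext t
    rw [(((hasDerivAt_id' t).const_mul θ).exp.const_mul θ).deriv]; ring
  have hcomp : (fun z : E => Real.exp (θ * ⟪e, z⟫)) = (fun t : ℝ => Real.exp (θ * t)) ∘ fun z : E => ⟪e, z⟫ := rfl
  constructor
  · rw [hcomp, gradient_comp_of_deriv ((hψ.differentiable (by norm_num)) _) ((hℓ.differentiable (by norm_num)) x),
      hgrad, hd1]
  · rw [hcomp, laplacian_comp_eq hψ hℓ x, hlapℓ, hgrad, hd2, hd1, he]
    simp

omit [MeasurableSpace E] [BorelSpace E] in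
/-- **Weak maximum principle** (Gilbarg–Trudinger Cor. 3.2; the "weak maximum principle in the
annulus" of Pineau–Vicol, proofs of Lemmas 5.4 and 5.6): on a bounded open set `D`, a `C²`
subsolution `φ` of `−Δφ − Dφ[b] + Vφ ≤ 0` with `V ≥ 0`, `b`, `V` bounded on `D`, which is `≤ M₀`
(`M₀ ≥ 0`) on `∂D`, is `≤ M₀` on `D̄`. (Perturb by `κ e^{θ⟪e,x⟫}` with `θ² − θB − V₀ > 0`; at an
interior maximum `Δ ≤ 0`, `D = 0`.) [cite: PineauVicol2026, proof of Lemma 5.4 ((5.7), weak maximum principle)] -/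
theorem weak_maximum_principle {D : Set E} (hD : IsOpen D) (hDb : Bornology.IsBounded D) {e : E} (he : ‖e‖ = 1)
    {φ : E → ℝ} (hφ : ContDiff ℝ 2 φ) {b : E → E} {V : E → ℝ} {B V₀ : ℝ} (hB : 0 ≤ B) (hV₀0 : 0 ≤ V₀)
    (hb : ∀ x ∈ D, ‖b x‖ ≤ B) (hV : ∀ x ∈ D, 0 ≤ V x) (hV₀ : ∀ x ∈ D, V x ≤ V₀)
    (hsub : ∀ x ∈ D, -(Δ φ) x - fderiv ℝ φ x (b x) + V x * φ x ≤ 0)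
    {M₀ : ℝ} (hM₀ : 0 ≤ M₀) (hbdry : ∀ x ∈ frontier D, φ x ≤ M₀) :
    ∀ x ∈ closure D, φ x ≤ M₀ := by
  haveI : CompleteSpace E := FiniteDimensional.complete ℝ E
  -- the barrier
  set θ : ℝ := B + V₀ + 1 with hθ
  have hθ1 : 1 ≤ θ := by rw [hθ]; linarith
  have hθkey : θ ^ 2 - θ * B - V₀ ≥ 1 := by nlinarith
  set hfun : E → ℝ := fun z => Real.exp (θ * ⟪e, z⟫) with hhfun
  have hhpos : ∀ z, 0 < hfun z := fun z => Real.exp_pos _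
  have hhs : ContDiff ℝ 2 hfun := Real.contDiff_exp.comp (contDiff_const.mul (contDiff_const.inner ℝ contDiff_id))
  -- `L₀ h ≤ -h` on `D`
  have hLh : ∀ x ∈ D, -(Δ hfun) x - fderiv ℝ hfun x (b x) + V x * hfun x ≤ -hfun x := by
    intro x hx
    obtain ⟨hg, hl⟩ := expInner_calculus he θ x
    rw [hl, ← inner_gradient_left, hg, real_inner_smul_left]
    have h1 : |⟪e, b x⟫| ≤ B := (abs_real_inner_le_norm _ _).trans (by rw [he, one_mul]; exact hb x hx)
    have hh := (hhpos x).le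
    have hcoef : -(θ ^ 2) - θ * ⟪e, b x⟫ + V x ≤ -1 := by
      nlinarith [hV₀ x hx, abs_le.1 h1]
    have := mul_le_mul_of_nonneg_right hcoef hh
    simp only [hhfun] at this hh ⊢
    nlinarith [this]
  -- compactness of the closure
  have hK : IsCompact (closure D) := Metric.isCompact_of_isClosed_isBounded isClosed_closure hDb.closure
  obtain ⟨H, hH⟩ : ∃ H, ∀ x ∈ closure D, hfun x ≤ H := by
    rcases (closure D).eq_empty_or_nonempty with h0 | hne
    · exact ⟨0, by simp [h0]⟩
    · obtain ⟨x, -, hx⟩ := hK.exists_isMaxOn hne hhs.continuous.continuousOn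
      exact ⟨hfun x, fun z hz => hx hz⟩
  -- the perturbed functions
  have main : ∀ κ : ℝ, 0 < κ → ∀ x ∈ closure D, φ x ≤ M₀ + κ * H := by
    intro κ hκ x hx
    set ψ : E → ℝ := fun z => φ z + κ * hfun z with hψ
    have hψs : ContDiff ℝ 2 ψ := hφ.add (contDiff_const.mul hhs)
    obtain ⟨xm, hxm, hmax⟩ := hK.exists_isMaxOn ⟨x, hx⟩ hψs.continuous.continuousOn
    have hφψ : φ x ≤ ψ x := by simp only [hψ]; nlinarith [hhpos x]
    have hψx : ψ x ≤ ψ xm := hmax hx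
    have hHx : κ * hfun x ≤ κ * H := mul_le_mul_of_nonneg_left (hH x hx) hκ.le
    by_cases hneg : ψ xm < 0
    · have : 0 ≤ M₀ + κ * H := by
        have := mul_pos hκ (hhpos x)
        linarith
      linarith
    push Not at hneg
    by_cases hbd : xm ∈ frontier D
    · have h1 := hbdry xm hbd
      have h2 := mul_le_mul_of_nonneg_left (hH xm hxm) hκ.le
      have : ψ xm ≤ M₀ + κ * H := by simp only [hψ]; linarith
      linarith
    · -- interior maximum: impossible unless handled above
      exfalso
      have hxmD : xm ∈ D := by
        have : xm ∈ closure D \ frontier D := ⟨hxm, hbd⟩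
        rwa [closure_sdiff_frontier, hD.interior_eq] at this
      have hloc : IsLocalMax ψ xm := by
        have hnhds : D ∈ nhds xm := hD.mem_nhds hxmD
        filter_upwards [hnhds] with z hz using hmax (subset_closure hz)
      have hD0 : fderiv ℝ ψ xm = 0 := hloc.fderiv_eq_zero
      have hΔ0 : (Δ ψ) xm ≤ 0 := laplacian_nonpos_of_isLocalMax hψs hloc
      have hΔadd : (Δ ψ) xm = (Δ φ) xm + κ * (Δ hfun) xm := by
        have e1 : ψ = φ + fun z => κ * hfun z := by funext z; simp [hψ]
        rw [e1, (hφ.contDiffAt).laplacian_add ((contDiff_const.mul hhs).contDiffAt)]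
        congr 1
        rw [show (fun z => κ * hfun z) = κ • hfun from funext fun z => by simp [smul_eq_mul],
          InnerProductSpace.laplacian_smul _ hhs.contDiffAt, smul_eq_mul]
      have hDadd : fderiv ℝ ψ xm = fderiv ℝ φ xm + κ • fderiv ℝ hfun xm := by
        simp only [hψ]
        rw [fderiv_fun_add (hφ.differentiable (by norm_num) xm) (((hhs.differentiable (by norm_num)) xm).const_mul κ),
          fderiv_const_mul ((hhs.differentiable (by norm_num)) xm)]
      have h1 := hsub xm hxmD
      have h2 := hLh xm hxmD
      -- from `Dψ = 0`: `Dφ(b) = -κ Dh(b)`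
      have hDφ : fderiv ℝ φ xm (b xm) + κ * fderiv ℝ hfun xm (b xm) = 0 := by
        have := congrArg (fun L : E →L[ℝ] ℝ => L (b xm)) hDadd
        simp only [hD0, zero_apply, add_apply, FunLike.coe_smul,
          Pi.smul_apply, smul_eq_mul] at this
        linarith
      have hV0 : 0 ≤ V xm * ψ xm := mul_nonneg (hV xm hxmD) hneg
      have hψm : ψ xm = φ xm + κ * hfun xm := rfl
      have := hhpos xm
      nlinarith [hΔ0, hΔadd, hDφ, h1, h2, hV0, mul_pos hκ this]
  intro x hx
  refine le_of_forall_pos_lt_add fun η hη => ?_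
  rcases le_or_gt H 0 with hH0 | hH0
  · have := main 1 one_pos x hx
    nlinarith
  · have := main (η / (2 * H)) (by positivity) x hx
    have e1 : η / (2 * H) * H = η / 2 := by field_simp
    rw [e1] at this
    linarith

/-! ### The barrier identities (5.6) and (5.9) -/

omit [MeasurableSpace E] [BorelSpace E] in
/-- `Σᵢ Df(bᵢ) Dg(bᵢ) = ⟪∇f, ∇g⟫`. [folklore] -/
theorem sum_fderiv_mul_fderiv_eq_inner (f g : E → ℝ) (x : E) :
    ∑ i, fderiv ℝ f x (stdOrthonormalBasis ℝ E i) * fderiv ℝ g x (stdOrthonormalBasis ℝ E i) =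
      ⟪gradient f x, gradient g x⟫ := by
  haveI : CompleteSpace E := FiniteDimensional.complete ℝ E
  rw [← (stdOrthonormalBasis ℝ E).sum_inner_mul_inner (gradient f x) (gradient g x)]
  refine Finset.sum_congr rfl fun i _ => ?_
  rw [← inner_gradient_left, ← inner_gradient_left]
  congr 1
  rw [real_inner_comm]

omit [MeasurableSpace E] [BorelSpace E] in
/-- `∇(e^{k|y|²}) = 2k e^{k|y|²} y`. [folklore] -/
theorem gradient_gaussProfile (k : ℝ) (y : E) :
    gradient (gaussProfile (E := E) k) y = (2 * (k * gaussProfile k y)) • y := by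
  haveI : CompleteSpace E := FiniteDimensional.complete ℝ E
  apply ext_inner_right ℝ
  intro v
  rw [inner_gradient_left, fderiv_gaussProfile_apply, real_inner_smul_left]

omit [MeasurableSpace E] [BorelSpace E] in
/-- **(5.6): the equation for `φ = v e^{−ε|y|²/4}`.** If `−Δv + Dv[½y − U] + ½⟪U,y⟫ v = 0` then
`−Δφ − Dφ[U + (ε−½)y] + V_ε φ = 0` with `V_ε = ε(1−ε)|y|²/4 − nε/2 + (1−ε)⟪U,y⟫/2`
(Pineau–Vicol's (5.6) with `λ_R = 0`, in dimension `n`). [cite: PineauVicol2026, (5.6)] -/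
theorem barrier_equation {U : E → E} {v : E → ℝ} (hv : ContDiff ℝ 2 v)
    (hM : ∀ y, -(Δ v) y + fderiv ℝ v y ((1 / 2 : ℝ) • y - U y) + ⟪U y, y⟫ / 2 * v y = 0) (ε : ℝ)
    {φ : E → ℝ} (hφ : φ = fun z => v z * gaussProfile (-(ε / 4)) z) (y : E) :
    -(Δ φ) y - fderiv ℝ φ y (U y + (ε - 1 / 2) • y) +
      (ε * (1 - ε) * ‖y‖ ^ 2 / 4 - Module.finrank ℝ E * ε / 2 + (1 - ε) * ⟪U y, y⟫ / 2) * φ y = 0 := by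
  subst hφ
  haveI : CompleteSpace E := FiniteDimensional.complete ℝ E
  have hh2 : ContDiff ℝ 2 (gaussProfile (E := E) (-(ε / 4))) := contDiff_gaussProfile _
  have hvd : Differentiable ℝ v := hv.differentiable (by norm_num)
  have hhd : Differentiable ℝ (gaussProfile (E := E) (-(ε / 4))) := hh2.differentiable (by norm_num)
  have hΔ : (Δ (fun z => v z * gaussProfile (-(ε / 4)) z)) y = v y * (Δ (gaussProfile (E := E) (-(ε / 4)))) y +
      gaussProfile (-(ε / 4)) y * (Δ v) y + 2 * ⟪gradient v y, gradient (gaussProfile (E := E) (-(ε / 4))) y⟫ := by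
    rw [laplacian_mul_eq (stdOrthonormalBasis ℝ E) hv hh2 y, sum_fderiv_mul_fderiv_eq_inner]
  have hD : ∀ w : E, fderiv ℝ (fun z => v z * gaussProfile (-(ε / 4)) z) y w =
      v y * fderiv ℝ (gaussProfile (E := E) (-(ε / 4))) y w + gaussProfile (-(ε / 4)) y * fderiv ℝ v y w := by
    intro w
    rw [fderiv_fun_mul (hvd y) (hhd y)]
    simp [smul_eq_mul]
  rw [hΔ, hD, laplacian_gaussProfile, gradient_gaussProfile, fderiv_gaussProfile_apply, inner_smul_right,
    ← inner_gradient_left (f := v)]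
  have hMy := hM y
  simp only
  rw [← inner_gradient_left (f := v)] at hMy
  simp only [inner_add_right, inner_sub_right, real_inner_smul_right, real_inner_self_eq_norm_sq,
    real_inner_comm (U y) y] at hMy ⊢
  linear_combination (gaussProfile (E := E) (-(ε / 4)) y) * hMy


omit [MeasurableSpace E] [BorelSpace E] in
/-- **(5.9): the barrier `g = e^{−ε|y|²/2}`** satisfies `−Δg − Dg[U + (ε−½)y] + V_ε g = −g F` with
`F = ε(1+ε)|y|²/4 − (1+ε)⟪U,y⟫/2 − nε/2` (Pineau–Vicol's (5.9), dimension `n`). [cite: PineauVicol2026, (5.9)] -/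
theorem barrier_gaussian (U : E → E) (ε : ℝ) (y : E) :
    -(Δ (gaussProfile (E := E) (-(ε / 2)))) y - fderiv ℝ (gaussProfile (E := E) (-(ε / 2))) y (U y + (ε - 1 / 2) • y) +
      (ε * (1 - ε) * ‖y‖ ^ 2 / 4 - Module.finrank ℝ E * ε / 2 + (1 - ε) * ⟪U y, y⟫ / 2) * gaussProfile (-(ε / 2)) y =
      -(gaussProfile (-(ε / 2)) y *
        (ε * (1 + ε) * ‖y‖ ^ 2 / 4 - (1 + ε) * ⟪U y, y⟫ / 2 - Module.finrank ℝ E * ε / 2)) := by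
  rw [laplacian_gaussProfile, fderiv_gaussProfile_apply]
  simp only [inner_add_right, real_inner_smul_right, real_inner_self_eq_norm_sq, real_inner_comm (U y) y]
  ring

/-! ### Harnack chains: two-sided bounds on balls in terms of the value at the origin -/

/-- **Harnack chain.** For a positive smooth solution of `Δw + Dw[β] + c₀w = 0` with `‖β‖ ≤ A` on
`B(0, R + 2)`: on `B̄(0, R)`, `w ≤ K w(0)` and `w(0) ≤ K w` with `K = (max C_H 1)^N`,
`N = ⌈R(A+5)⌉ + 1` depending only on `R`, `A` and the dimension. [folklore] -/
theorem harnack_chain {w : E → ℝ} (hw : ContDiff ℝ ∞ w) (hwpos : ∀ x, 0 < w x) {β : E → E}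
    (hβ : Continuous β) {c₀ : ℝ} (hc₀ : 0 ≤ c₀)
    (heq : ∀ x, (Δ w) x + fderiv ℝ w x (β x) + c₀ * w x = 0)
    {R A : ℝ} (hR : 0 < R) (hA : 0 ≤ A) (hAbd : ∀ x ∈ Metric.ball (0 : E) (R + 2), ‖β x‖ ≤ A)
    {z : E} (hz : z ∈ Metric.closedBall (0 : E) R) :
    w z ≤ (max (harnackConst E) 1) ^ (⌈R * (A + 5)⌉₊ + 1) * w 0 ∧
      w 0 ≤ (max (harnackConst E) 1) ^ (⌈R * (A + 5)⌉₊ + 1) * w z := by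
  set C := max (harnackConst E) 1 with hCdef
  have hC1 : 1 ≤ C := le_max_right _ _
  set N : ℕ := ⌈R * (A + 5)⌉₊ + 1 with hN
  set lam : ℝ := 1 / (A + 5) with hlam
  have hlampos : 0 < lam := by positivity
  have hNpos : (0 : ℝ) < N := by positivity
  have hstep : R / N < lam := by
    rw [hlam, div_lt_div_iff₀ hNpos (by positivity), one_mul]
    have h1 : R * (A + 5) ≤ ⌈R * (A + 5)⌉₊ := Nat.le_ceil _
    have h2 : (N : ℝ) = ⌈R * (A + 5)⌉₊ + 1 := by simp [hN]
    rw [h2]; linarith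
  have hzR : ‖z‖ ≤ R := by simpa [Metric.mem_closedBall, dist_zero_right] using hz
  -- the points of the chain
  set q : ℕ → E := fun k => ((k : ℝ) / N) • z with hq
  have hq0 : q 0 = 0 := by simp [hq]
  have hqN : q N = z := by simp [hq]
  have hqnorm : ∀ k, k ≤ N → ‖q k‖ ≤ R := by
    intro k hk
    rw [hq]; dsimp only
    rw [norm_smul, Real.norm_eq_abs, abs_of_nonneg (by positivity)]
    have : (k : ℝ) / N ≤ 1 := by rw [div_le_one hNpos]; exact_mod_cast hk
    nlinarith [norm_nonneg z]
  have hqdist : ∀ k, dist (q k) (q (k + 1)) < lam := by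
    intro k
    rw [dist_eq_norm, hq]; dsimp only
    rw [← sub_smul, norm_smul, show (k : ℝ) / N - ((k + 1 : ℕ) : ℝ) / N = -(1 / N) by push_cast; ring,
      norm_neg, Real.norm_eq_abs, abs_of_pos (by positivity)]
    calc 1 / (N : ℝ) * ‖z‖ ≤ 1 / N * R := mul_le_mul_of_nonneg_left hzR (by positivity)
      _ = R / N := by ring
      _ < lam := hstep
  -- the drift bound on the Harnack balls
  have hbd : ∀ k, k ≤ N → ∀ x ∈ Metric.ball (q k) (9 * lam), lam * ‖β x‖ ≤ 1 := by
    intro k hk x hx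
    have hlam5 : 9 * lam ≤ 9 / 5 := by
      rw [hlam]
      have : 1 / (A + 5) ≤ 1 / 5 := one_div_le_one_div_of_le (by norm_num) (by linarith)
      linarith
    have hxn : ‖x‖ < R + 2 := by
      rw [Metric.mem_ball, dist_eq_norm] at hx
      have := norm_le_norm_add_norm_sub' x (q k)
      have := hqnorm k hk
      have : ‖x - q k‖ < 9 / 5 := lt_of_lt_of_le hx hlam5
      linarith [norm_sub_rev x (q k)]
    have hb := hAbd x (by simpa [Metric.mem_ball, dist_zero_right] using hxn)
    rw [hlam]
    rw [div_mul_eq_mul_div, one_mul, div_le_one (by positivity)]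
    linarith
  -- one step in each direction
  have hfwd : ∀ k, k + 1 ≤ N → w (q k) ≤ C * w (q (k + 1)) := by
    intro k hk
    have h := harnack_of_solution hw hwpos hβ hc₀ heq hlampos (hbd (k + 1) hk)
      (x₁ := q k) (x₂ := q (k + 1)) (by rw [Metric.mem_ball]; exact hqdist k)
      (Metric.mem_ball_self (by positivity))
    exact h.trans (mul_le_mul_of_nonneg_right (le_max_left _ _) (hwpos _).le)
  have hbwd : ∀ k, k + 1 ≤ N → w (q (k + 1)) ≤ C * w (q k) := by
    intro k hk
    have h := harnack_of_solution hw hwpos hβ hc₀ heq hlampos (hbd k (by omega))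
      (x₁ := q (k + 1)) (x₂ := q k) (by rw [Metric.mem_ball, dist_comm]; exact hqdist k)
      (Metric.mem_ball_self (by positivity))
    exact h.trans (mul_le_mul_of_nonneg_right (le_max_left _ _) (hwpos _).le)
  -- induction
  have hind : ∀ k, k ≤ N → w (q k) ≤ C ^ k * w 0 ∧ w 0 ≤ C ^ k * w (q k) := by
    intro k
    induction k with
    | zero => intro _; simp [hq0]
    | succ k ih =>
        intro hk
        obtain ⟨ih1, ih2⟩ := ih (by omega)
        have hCk : 0 ≤ C ^ k := by positivity
        constructor
        · calc w (q (k + 1)) ≤ C * w (q k) := hbwd k hk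
            _ ≤ C * (C ^ k * w 0) := mul_le_mul_of_nonneg_left ih1 (by positivity)
            _ = C ^ (k + 1) * w 0 := by ring
        · calc w 0 ≤ C ^ k * w (q k) := ih2
            _ ≤ C ^ k * (C * w (q (k + 1))) := mul_le_mul_of_nonneg_left (hfwd k hk) hCk
            _ = C ^ (k + 1) * w (q (k + 1)) := by ring
  have := hind N le_rfl
  rwa [hqN] at this

/-! ### A priori sub-Gaussian decay from the Harnack inequality and `v ∈ L²(γ)` -/

omit [NormedAddCommGroup E] [InnerProductSpace ℝ E] [FiniteDimensional ℝ E] [MeasurableSpace E] [BorelSpace E] in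
/-- `e^{−ar² + br + c} ≤ η` for `r` large (`a > 0`). [folklore] -/
theorem exists_exp_quadratic_le {a : ℝ} (ha : 0 < a) (b c : ℝ) {η : ℝ} (hη : 0 < η) :
    ∃ R₀ : ℝ, 0 ≤ R₀ ∧ ∀ r, R₀ ≤ r → Real.exp (-a * r ^ 2 + b * r + c) ≤ η := by
  refine ⟨max 0 (max ((|b| + 1) / a) (c - Real.log η)), le_max_left _ _, fun r hr => ?_⟩
  have hr0 : 0 ≤ r := (le_max_left _ _).trans hr
  have hr1 : (|b| + 1) / a ≤ r := ((le_max_left _ _).trans (le_max_right _ _)).trans hr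
  have hr2 : c - Real.log η ≤ r := ((le_max_right _ _).trans (le_max_right _ _)).trans hr
  have h1 : a * r ≥ |b| + 1 := by rw [div_le_iff₀ ha] at hr1; linarith
  have h2 : -a * r ^ 2 + b * r ≤ -r := by
    have : b * r ≤ |b| * r := mul_le_mul_of_nonneg_right (le_abs_self b) hr0
    nlinarith
  calc Real.exp (-a * r ^ 2 + b * r + c) ≤ Real.exp (-r + c) := Real.exp_le_exp.2 (by linarith)
    _ ≤ Real.exp (Real.log η) := Real.exp_le_exp.2 (by linarith)
    _ = η := Real.exp_log hη

/-- **Mean-value bound from Harnack**: `w(y) · |B(y, λ)| ≤ C_H ∫_{B(y,λ)} w`. [folklore] -/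
theorem harnack_mean {w : E → ℝ} (hw : ContDiff ℝ ∞ w) (hwpos : ∀ x, 0 < w x) {β : E → E}
    (hβ : Continuous β) {c₀ : ℝ} (hc₀ : 0 ≤ c₀)
    (heq : ∀ x, (Δ w) x + fderiv ℝ w x (β x) + c₀ * w x = 0)
    {y : E} {lam : ℝ} (hlam : 0 < lam) (hbd : ∀ x ∈ Metric.ball y (9 * lam), lam * ‖β x‖ ≤ 1) :
    w y * (volume (Metric.ball y lam)).toReal ≤ harnackConst E * ∫ x in Metric.ball y lam, w x := by
  have hH : ∀ x₂ ∈ Metric.ball y lam, w y ≤ harnackConst E * w x₂ := fun x₂ hx₂ =>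
    harnack_of_solution hw hwpos hβ hc₀ heq hlam hbd (Metric.mem_ball_self hlam)
      (Metric.ball_subset_ball (by linarith) hx₂)
  have hfin : volume (Metric.ball y lam) < ⊤ := measure_ball_lt_top
  calc w y * (volume (Metric.ball y lam)).toReal = ∫ _ in Metric.ball y lam, w y := by
        rw [setIntegral_const, smul_eq_mul, mul_comm]; rfl
    _ ≤ ∫ x in Metric.ball y lam, harnackConst E * w x := by
        refine setIntegral_mono_on (integrableOn_const hfin.ne) ?_ measurableSet_ball hH
        exact ((continuous_const.mul hw.continuous).continuousOn.integrableOn_compact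
          (isCompact_closedBall y lam)).mono_set Metric.ball_subset_closedBall
    _ = harnackConst E * ∫ x in Metric.ball y lam, w x := integral_const_mul _ _

omit [MeasurableSpace E] [BorelSpace E] in
/-- **The `w`-equation**: for `w = γ v` with `N v = 0`, `Δw + Dw[U + ½y] + (n/2) w = 0`
(`L*w = 0`, (5.1)). [cite: PineauVicol2026, (5.1)–(5.2)] -/
theorem DriftHyp.w_equation {U : E → E} {C₀ : ℝ} (h : DriftHyp U C₀) {v : E → ℝ} (hv : ContDiff ℝ 2 v)
    (hN : ∀ y, adjN (fun z : E => (1 / 2 : ℝ) • z + U z) v y = 0) (y : E) :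
    (Δ (fun z => gaussWeight z * v z)) y + fderiv ℝ (fun z => gaussWeight z * v z) y (U y + (1 / 2 : ℝ) • y) +
      Module.finrank ℝ E / 2 * (gaussWeight y * v y) = 0 := by
  haveI : CompleteSpace E := FiniteDimensional.complete ℝ E
  have e := hN y
  unfold adjN at e
  have hθd : DifferentiableAt ℝ (fun z => gaussWeight z * v z) y :=
    ((contDiff_gaussWeight.mul hv).differentiable (by norm_num)) y
  have hXd : DifferentiableAt ℝ (fun z : E => (1 / 2 : ℝ) • z + U z) y :=
    ((differentiableAt_id).const_smul (1 / 2 : ℝ)).add (h.contDiff_one.differentiable one_ne_zero y)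
  rw [divergence_smul_apply (θ := fun z => gaussWeight z * v z) (u := fun z : E => (1 / 2 : ℝ) • z + U z) hθd hXd,
    divergence_half_add (h.contDiff_one.differentiable one_ne_zero), h.div_eq_zero, real_inner_comm,
    inner_gradient_left, add_comm ((1 / 2 : ℝ) • y)] at e
  linarith

omit [MeasurableSpace E] [BorelSpace E] in
/-- **The `v`-equation** (non-divergence form): `−Δv + Dv[½y − U] + ½⟪U,y⟫ v = 0`. [folklore] -/
theorem DriftHyp.v_equation {U : E → E} {C₀ : ℝ} (h : DriftHyp U C₀) {v : E → ℝ} (hv : ContDiff ℝ 2 v)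
    (hN : ∀ y, adjN (fun z : E => (1 / 2 : ℝ) • z + U z) v y = 0) (y : E) :
    -(Δ v) y + fderiv ℝ v y ((1 / 2 : ℝ) • y - U y) + ⟪U y, y⟫ / 2 * v y = 0 := by
  have e := hN y
  rw [adjN_eq_neg_mul hv h.contDiff_one y, h.div_eq_zero y, sub_zero, neg_eq_zero] at e
  rcases mul_eq_zero.1 e with h0 | h0
  · exact absurd h0 (gaussWeight_pos y).ne'
  · exact h0

/-- `γ v²` is integrable for `v ∈ L²(γ)`. [folklore] -/
theorem integrable_gaussWeight_mul_sq_of_memLp {v : E → ℝ} (hv : MemLp v 2 (gaussMeasure (E := E))) :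
    Integrable (fun y => gaussWeight y * v y ^ 2) := by
  have h := (memLp_two_iff_integrable_sq hv.1).1 hv
  rw [integrable_gaussMeasure_iff] at h
  simpa only [smul_eq_mul] using h
set_option maxHeartbeats 400000 in -- buildfix (bf3-g27): 160k/180k FAIL, 200k PASS at accept time; line-neutral budget line
/-- **A priori sub-Gaussian decay.** For a positive smooth solution `v` of `N v = 0` with
`v ∈ L²(γ)` and `ε > ½`, `v(y) e^{−ε|y|²/4} → 0` as `|y| → ∞` (Harnack mean-value bound at scale
`λ = 1/(C₀ + |y|/2 + 6)`, the Gaussian weight on the ball, and `∫γv² < ∞`) — the qualitative input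
that replaces the Dirichlet condition `φ_R = 0` on `∂B_R` of Pineau–Vicol's Lemma 5.4. [folklore] -/
theorem DriftHyp.decay {U : E → E} {C₀ : ℝ} (h : DriftHyp U C₀) {v : E → ℝ} (hv : ContDiff ℝ ∞ v)
    (hvpos : ∀ y, 0 < v y) (hv2 : MemLp v 2 (gaussMeasure (E := E)))
    (hN : ∀ y, adjN (fun z : E => (1 / 2 : ℝ) • z + U z) v y = 0) {ε : ℝ} (hε : 1 / 2 < ε)
    {η : ℝ} (hη : 0 < η) :
    ∃ R₀ : ℝ, ∀ y, R₀ ≤ ‖y‖ → v y * gaussProfile (-(ε / 4)) y ≤ η := by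
  haveI : CompleteSpace E := FiniteDimensional.complete ℝ E
  set n := Module.finrank ℝ E with hn
  have hC₀ := h.nonneg
  -- the `w`-equation
  set w : E → ℝ := fun z => gaussWeight z * v z with hw
  have hws : ContDiff ℝ ∞ w := contDiff_gaussWeight.mul hv
  have hwpos : ∀ x, 0 < w x := fun x => mul_pos (gaussWeight_pos x) (hvpos x)
  have hweq : ∀ x, (Δ w) x + fderiv ℝ w x (U x + (1 / 2 : ℝ) • x) + n / 2 * w x = 0 :=
    h.w_equation (hv.of_le (by norm_cast)) hN
  have hβ : Continuous fun x : E => U x + (1 / 2 : ℝ) • x := h.continuous.add (continuous_id.const_smul _)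
  -- constants
  set S : ℝ := ∫ y, gaussWeight y * v y ^ 2 with hS
  have hS0 : 0 ≤ S := integral_nonneg fun y => mul_nonneg (gaussWeight_pos y).le (sq_nonneg _)
  set V₁ : ℝ := (volume (Metric.ball (0 : E) 1)).toReal with hV₁
  have hV₁pos : 0 < V₁ := ENNReal.toReal_pos (Metric.measure_ball_pos volume (0 : E) one_pos).ne' measure_ball_lt_top.ne
  set C := harnackConst E with hC
  have hCpos : 0 < C := harnackConst_pos
  clear_value S C V₁
  set K : ℝ := C / 2 * (1 + S / V₁) with hK
  have hKpos : 0 < K := mul_pos (div_pos hCpos two_pos) (by positivity)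
  clear_value K
  obtain ⟨R₁, hR₁0, hR₁⟩ := exists_exp_quadratic_le (a := (2 * ε - 1) / 8) (by linarith) (1 / 4 + n / 2)
    (n * (C₀ + 6) - 1 / 8) (η := η / K) (by positivity)
  refine ⟨max 1 R₁, fun y hy => ?_⟩
  have hy1 : 1 ≤ ‖y‖ := (le_max_left _ _).trans hy
  have hyR : R₁ ≤ ‖y‖ := (le_max_right _ _).trans hy
  -- the scale
  set lam : ℝ := 1 / (C₀ + ‖y‖ / 2 + 6) with hlam
  have hlampos : 0 < lam := by positivity
  have hlam1 : lam ≤ 1 / 6 := one_div_le_one_div_of_le (by norm_num) (by linarith [norm_nonneg y])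
  have hbd : ∀ x ∈ Metric.ball y (9 * lam), lam * ‖U x + (1 / 2 : ℝ) • x‖ ≤ 1 := by
    intro x hx
    rw [Metric.mem_ball, dist_eq_norm] at hx
    have hxn : ‖x‖ ≤ ‖y‖ + 2 := by
      have := norm_le_norm_add_norm_sub' x y
      nlinarith
    have hb : ‖U x + (1 / 2 : ℝ) • x‖ ≤ C₀ + ‖y‖ / 2 + 1 := by
      calc ‖U x + (1 / 2 : ℝ) • x‖ ≤ ‖U x‖ + ‖(1 / 2 : ℝ) • x‖ := norm_add_le _ _
        _ ≤ C₀ + (1 / 2) * ‖x‖ := by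
            rw [norm_smul, Real.norm_eq_abs, abs_of_pos (by norm_num : (0:ℝ) < 1 / 2)]
            exact add_le_add (h.norm_le x) le_rfl
        _ ≤ C₀ + ‖y‖ / 2 + 1 := by linarith
    rw [hlam, div_mul_eq_mul_div, one_mul, div_le_one (by positivity)]
    linarith
  -- Harnack mean value
  have hmean := harnack_mean hws hwpos hβ (by positivity : (0 : ℝ) ≤ n / 2) hweq hlampos hbd
  rw [← hC] at hmean
  -- the Gaussian on the ball
  set T : ℝ := Real.exp (-(‖y‖ - 1) ^ 2 / 8) with hT
  have hTpos : 0 < T := Real.exp_pos _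
  clear_value T
  have hγB : ∀ x ∈ Metric.ball y lam, gaussWeight x ≤ T ^ 2 := by
    intro x hx
    rw [Metric.mem_ball, dist_eq_norm] at hx
    have hxn : ‖y‖ - 1 ≤ ‖x‖ := by
      have := norm_sub_norm_le y x
      rw [norm_sub_rev] at this
      linarith
    rw [hT, ← Real.exp_nat_mul, gaussWeight]
    apply Real.exp_le_exp.2
    push_cast
    have : (‖y‖ - 1) ^ 2 ≤ ‖x‖ ^ 2 := by nlinarith [norm_nonneg x]
    linarith
  -- `∫_B w ≤ ½ T (|B| + S)`
  have hvolfin : volume (Metric.ball y lam) < ⊤ := measure_ball_lt_top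
  have hvol : (volume (Metric.ball y lam)).toReal = lam ^ n * V₁ := by
    rw [hV₁, hn, Measure.addHaar_ball_of_pos volume y hlampos, ENNReal.toReal_mul,
      ENNReal.toReal_ofReal (by positivity)]
  have hvolpos : 0 < (volume (Metric.ball y lam)).toReal := by rw [hvol]; positivity
  have hT1 : T ≤ 1 := by
    rw [hT]; apply Real.exp_le_one_iff.2
    have := sq_nonneg (‖y‖ - 1); apply div_nonpos_of_nonpos_of_nonneg <;> linarith
  have hint : ∫ x in Metric.ball y lam, w x ≤ (1 / 2) * (T * ((volume (Metric.ball y lam)).toReal + S)) := by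
    have i1 : IntegrableOn (fun x => gaussWeight x * v x ^ 2) (Metric.ball y lam) :=
      (integrable_gaussWeight_mul_sq_of_memLp hv2).integrableOn
    have i2 : IntegrableOn (fun _ : E => T) (Metric.ball y lam) := integrableOn_const hvolfin.ne
    have hpt : ∀ x ∈ Metric.ball y lam, w x ≤ (1 / 2) * (T + T * (gaussWeight x * v x ^ 2)) := by
      intro x hx
      have hg := (gaussWeight_pos x).le
      have hγT := hγB x hx
      -- AM–GM: `γ v ≤ ½ (γ/T + T γ v²)` and `γ/T ≤ T`
      have h1 : gaussWeight x * v x ≤ (1 / 2) * (gaussWeight x / T + T * (gaussWeight x * v x ^ 2)) := by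
        have hsq : 0 ≤ gaussWeight x / T * (1 - T * v x) ^ 2 := by positivity
        have e : (1 / 2) * (gaussWeight x / T + T * (gaussWeight x * v x ^ 2)) - gaussWeight x * v x =
            (1 / 2) * (gaussWeight x / T * (1 - T * v x) ^ 2) := by field_simp; ring
        nlinarith [hsq, e]
      have h2 : gaussWeight x / T ≤ T := by rw [div_le_iff₀ hTpos]; nlinarith
      show gaussWeight x * v x ≤ _
      nlinarith [h1, h2]
    calc ∫ x in Metric.ball y lam, w x ≤ ∫ x in Metric.ball y lam, (1 / 2) * (T + T * (gaussWeight x * v x ^ 2)) := by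
          refine setIntegral_mono_on ?_ ((i2.add (i1.const_mul _)).const_mul _) measurableSet_ball hpt
          exact (hws.continuous.continuousOn.integrableOn_compact (isCompact_closedBall y lam)).mono_set
            Metric.ball_subset_closedBall
      _ = (1 / 2) * (T * (volume (Metric.ball y lam)).toReal + T * ∫ x in Metric.ball y lam, gaussWeight x * v x ^ 2) := by
          rw [integral_const_mul, integral_add i2 (i1.const_mul _), integral_const_mul, setIntegral_const, smul_eq_mul,
            mul_comm _ T]
          rfl
      _ ≤ (1 / 2) * (T * ((volume (Metric.ball y lam)).toReal + S)) := by
          have : ∫ x in Metric.ball y lam, gaussWeight x * v x ^ 2 ≤ S :=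
            hS ▸ setIntegral_le_integral (integrable_gaussWeight_mul_sq_of_memLp hv2)
              (Eventually.of_forall fun x => mul_nonneg (gaussWeight_pos x).le (sq_nonneg _))
          nlinarith [hTpos]
  -- `w(y) ≤ (C/2) T (1 + S/|B|)`
  have hwy : w y ≤ C / 2 * T * (1 + S / (volume (Metric.ball y lam)).toReal) := by
    have := hmean.trans (mul_le_mul_of_nonneg_left hint hCpos.le)
    rw [← le_div_iff₀ hvolpos] at this
    refine this.trans (le_of_eq ?_)
    rw [div_eq_iff hvolpos.ne']
    field_simp
  -- `1/|B| ≤ e^{n x₀}/V₁`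
  set x₀ : ℝ := C₀ + ‖y‖ / 2 + 6 with hx₀
  have hx₀0 : 0 ≤ x₀ := by positivity
  have hlaminv : 1 / lam ^ n ≤ Real.exp (n * x₀) := by
    rw [hlam, one_div_pow, one_div_one_div, Real.exp_nat_mul]
    exact pow_le_pow_left₀ hx₀0 (by linarith [Real.add_one_le_exp x₀]) n
  have hlampow : 0 < lam ^ n := by positivity
  have hSvol : S / (volume (Metric.ball y lam)).toReal ≤ S / V₁ * Real.exp (n * x₀) := by
    rw [hvol, show S / (lam ^ n * V₁) = S / V₁ * (1 / lam ^ n) by field_simp]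
    exact mul_le_mul_of_nonneg_left hlaminv (by positivity)
  have hexp1 : 1 ≤ Real.exp (n * x₀) := Real.one_le_exp (by positivity)
  have hA : 1 + S / (volume (Metric.ball y lam)).toReal ≤ (1 + S / V₁) * Real.exp (n * x₀) := by
    have e : (1 + S / V₁) * Real.exp (n * x₀) = Real.exp (n * x₀) + S / V₁ * Real.exp (n * x₀) := by ring
    rw [e]; exact add_le_add hexp1 hSvol
  have hCT : 0 ≤ C / 2 * T := mul_nonneg (div_nonneg hCpos.le two_pos.le) hTpos.le
  have hwy1 : C / 2 * T * (1 + S / (volume (Metric.ball y lam)).toReal) ≤ C / 2 * T * ((1 + S / V₁) * Real.exp (n * x₀)) :=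
    mul_le_mul_of_nonneg_left hA hCT
  have hKe : C / 2 * T * ((1 + S / V₁) * Real.exp (n * x₀)) = K * (T * Real.exp (n * x₀)) := by
    simp only [hK]; ring
  have hwy2 : w y ≤ K * (T * Real.exp (n * x₀)) := hKe ▸ hwy.trans hwy1
  -- conclude
  have hφ : v y * gaussProfile (-(ε / 4)) y = w y * Real.exp ((1 - ε) * ‖y‖ ^ 2 / 4) := by
    simp only [hw, gaussProfile, gaussWeight]
    rw [mul_comm (Real.exp _) (v y), mul_assoc, ← Real.exp_add]
    congr 2; ring
  rw [hφ]
  have hE : T * Real.exp (n * x₀) * Real.exp ((1 - ε) * ‖y‖ ^ 2 / 4) =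
      Real.exp (-((2 * ε - 1) / 8) * ‖y‖ ^ 2 + (1 / 4 + n / 2) * ‖y‖ + (n * (C₀ + 6) - 1 / 8)) := by
    rw [hT, hx₀, ← Real.exp_add, ← Real.exp_add]; congr 1; ring
  have hfin := hR₁ ‖y‖ hyR
  calc w y * Real.exp ((1 - ε) * ‖y‖ ^ 2 / 4) ≤ K * (T * Real.exp (n * x₀)) * Real.exp ((1 - ε) * ‖y‖ ^ 2 / 4) :=
        mul_le_mul_of_nonneg_right hwy2 (Real.exp_pos _).le
    _ = K * Real.exp (-((2 * ε - 1) / 8) * ‖y‖ ^ 2 + (1 / 4 + n / 2) * ‖y‖ + (n * (C₀ + 6) - 1 / 8)) := by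
        rw [← hE]; ring
    _ ≤ K * (η / K) := mul_le_mul_of_nonneg_left hfin hKpos.le
    _ = η := by field_simp

/-! ### The upper Gaussian bound (Pineau–Vicol Lemma 5.4 / (5.3), via the barrier `φ_ε`) -/

omit [InnerProductSpace ℝ E] [FiniteDimensional ℝ E] [MeasurableSpace E] [BorelSpace E] in
/-- `φ_ε = v e^{−ε|y|²/4} = w e^{(1−ε)|y|²/4}` with `w = γ v`. [folklore] -/
theorem phiEps_eq (v : E → ℝ) (ε : ℝ) (y : E) :
    v y * gaussProfile (-(ε / 4)) y = gaussWeight y * v y * Real.exp ((1 - ε) * ‖y‖ ^ 2 / 4) := by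
  simp only [gaussProfile, gaussWeight]
  rw [mul_comm (Real.exp _) (v y), mul_assoc, ← Real.exp_add]
  congr 2; ring

omit [InnerProductSpace ℝ E] [FiniteDimensional ℝ E] [MeasurableSpace E] [BorelSpace E] in
/-- The frontier of an open annulus lies in the two spheres. [folklore] -/
theorem frontier_annulus_subset (a b : ℝ) :
    frontier {y : E | a < ‖y‖ ∧ ‖y‖ < b} ⊆ {y | ‖y‖ = a ∨ ‖y‖ = b} := by
  intro x hx
  have hopen : IsOpen {y : E | a < ‖y‖ ∧ ‖y‖ < b} :=
    (isOpen_lt continuous_const continuous_norm).inter (isOpen_lt continuous_norm continuous_const)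
  rw [hopen.frontier_eq] at hx
  obtain ⟨hx1, hx2⟩ := hx
  have hcl : closure {y : E | a < ‖y‖ ∧ ‖y‖ < b} ⊆ {y : E | a ≤ ‖y‖ ∧ ‖y‖ ≤ b} :=
    closure_minimal (fun y hy => ⟨hy.1.le, hy.2.le⟩)
      ((isClosed_le continuous_const continuous_norm).inter (isClosed_le continuous_norm continuous_const))
  have h1 := hcl hx1
  simp only [Set.mem_setOf_eq, not_and, not_lt] at h1 hx2 ⊢
  by_cases ha : ‖x‖ = a
  · exact Or.inl ha
  · right
    have : a < ‖x‖ := lt_of_le_of_ne h1.1 (Ne.symm ha)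
    exact le_antisymm h1.2 (hx2 this)

/-- The radius beyond which the barrier potential `V_ε` of (5.7) is nonnegative. [cite: PineauVicol2026, (5.7)–(5.8)] -/
def upperRadius (n : ℕ) (C₀ ε : ℝ) : ℝ := Real.sqrt ((2 * n * ε + 2 * (1 - ε) * C₀) / (ε * (1 - ε)))

omit [FiniteDimensional ℝ E] [MeasurableSpace E] [BorelSpace E] in
/-- `V_ε ≥ 0` outside `B(0, R_ε)`. [cite: PineauVicol2026, (5.7)–(5.8)] -/
theorem DriftHyp.potential_nonneg {U : E → E} {C₀ : ℝ} (h : DriftHyp U C₀) {ε : ℝ} (hε : 0 < ε) (hε1 : ε < 1)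
    {y : E} (hy : upperRadius (Module.finrank ℝ E) C₀ ε ≤ ‖y‖) :
    0 ≤ ε * (1 - ε) * ‖y‖ ^ 2 / 4 - Module.finrank ℝ E * ε / 2 + (1 - ε) * ⟪U y, y⟫ / 2 := by
  have hC₀ := h.nonneg
  have hin : -C₀ ≤ ⟪U y, y⟫ := (abs_le.1 (h.abs_inner_le y)).1
  have hpos : 0 < ε * (1 - ε) := mul_pos hε (by linarith)
  have hsq : (2 * (Module.finrank ℝ E) * ε + 2 * (1 - ε) * C₀) / (ε * (1 - ε)) ≤ ‖y‖ ^ 2 := by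
    have h0 : 0 ≤ (2 * (Module.finrank ℝ E) * ε + 2 * (1 - ε) * C₀) / (ε * (1 - ε)) := by
      apply div_nonneg _ hpos.le; nlinarith
    calc _ = (upperRadius (Module.finrank ℝ E) C₀ ε) ^ 2 := by rw [upperRadius, Real.sq_sqrt h0]
      _ ≤ ‖y‖ ^ 2 := pow_le_pow_left₀ (Real.sqrt_nonneg _) hy 2
  rw [div_le_iff₀ hpos] at hsq
  nlinarith

/-- **Upper Gaussian bound** (Pineau–Vicol (5.3), upper half; Lemma 5.4 on the whole space, the
Dirichlet condition replaced by the a priori decay `DriftHyp.decay`): for a positive smooth solution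
`v ∈ L²(γ)` of `N v = 0` and `ε ∈ (½, 1)`,
`v(y) e^{−ε|y|²/4} ≤ (max C_H 1)^N · e^{(1−ε)R_ε²/4} · v(0)` for all `y`, with `N`, `R_ε`
depending only on `ε`, `C₀` and the dimension. [cite: PineauVicol2026, Lemma 5.4 and (5.3)] -/
theorem DriftHyp.upper_bound {U : E → E} {C₀ : ℝ} (h : DriftHyp U C₀) {v : E → ℝ} (hv : ContDiff ℝ ∞ v)
    (hvpos : ∀ y, 0 < v y) (hv2 : MemLp v 2 (gaussMeasure (E := E)))
    (hN : ∀ y, adjN (fun z : E => (1 / 2 : ℝ) • z + U z) v y = 0) {ε : ℝ} (hε : 1 / 2 < ε) (hε1 : ε < 1)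
    {e : E} (he : ‖e‖ = 1) (y : E) :
    v y * gaussProfile (-(ε / 4)) y ≤
      (max (harnackConst E) 1) ^ (⌈upperRadius (Module.finrank ℝ E) C₀ ε *
          (C₀ + (upperRadius (Module.finrank ℝ E) C₀ ε + 2) / 2 + 5)⌉₊ + 1) *
        Real.exp ((1 - ε) * (upperRadius (Module.finrank ℝ E) C₀ ε) ^ 2 / 4) * v 0 := by
  haveI : CompleteSpace E := FiniteDimensional.complete ℝ E
  set n := Module.finrank ℝ E with hn
  set Rε := upperRadius n C₀ ε with hRε
  have hRε0 : 0 ≤ Rε := Real.sqrt_nonneg _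
  have hC₀ := h.nonneg
  set Cm := max (harnackConst E) 1 with hCm
  have hCm1 : 1 ≤ Cm := le_max_right _ _
  set N : ℕ := ⌈Rε * (C₀ + (Rε + 2) / 2 + 5)⌉₊ + 1 with hNdef
  set M : ℝ := Cm ^ N * Real.exp ((1 - ε) * Rε ^ 2 / 4) * v 0 with hM
  have hv0 := hvpos 0
  have hMpos : 0 < M := by positivity
  clear_value Cm
  -- the `w`-equation and the chain bound on `B̄(0, R_ε)`
  set w : E → ℝ := fun z => gaussWeight z * v z with hw
  have hws : ContDiff ℝ ∞ w := contDiff_gaussWeight.mul hv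
  have hwpos : ∀ x, 0 < w x := fun x => mul_pos (gaussWeight_pos x) (hvpos x)
  have hweq : ∀ x, (Δ w) x + fderiv ℝ w x (U x + (1 / 2 : ℝ) • x) + n / 2 * w x = 0 :=
    h.w_equation (hv.of_le (by norm_cast)) hN
  have hβ : Continuous fun x : E => U x + (1 / 2 : ℝ) • x := h.continuous.add (continuous_id.const_smul _)
  have hw0 : w 0 = v 0 := by simp [hw, gaussWeight]
  have hball : ∀ z ∈ Metric.closedBall (0 : E) Rε, v z * gaussProfile (-(ε / 4)) z ≤ M := by
    intro z hz
    have hzR : ‖z‖ ≤ Rε := by simpa [Metric.mem_closedBall, dist_zero_right] using hz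
    rw [phiEps_eq]
    have hchain : w z ≤ Cm ^ N * w 0 := by
      rcases hRε0.eq_or_lt with h0 | hRpos
      · have : z = 0 := by rw [← norm_le_zero_iff]; exact hzR.trans_eq h0.symm
        subst this
        have : (1 : ℝ) ≤ Cm ^ N := one_le_pow₀ hCm1
        nlinarith [hwpos 0]
      · have hAbd : ∀ x ∈ Metric.ball (0 : E) (Rε + 2), ‖U x + (1 / 2 : ℝ) • x‖ ≤ C₀ + (Rε + 2) / 2 := by
          intro x hx
          rw [Metric.mem_ball, dist_zero_right] at hx
          calc ‖U x + (1 / 2 : ℝ) • x‖ ≤ ‖U x‖ + ‖(1 / 2 : ℝ) • x‖ := norm_add_le _ _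
            _ ≤ C₀ + (Rε + 2) / 2 := by
                rw [norm_smul, Real.norm_eq_abs, abs_of_pos (by norm_num : (0:ℝ) < 1 / 2)]
                exact add_le_add (h.norm_le x) (by linarith)
        have := (harnack_chain hws hwpos hβ (by positivity : (0 : ℝ) ≤ n / 2) hweq hRpos (by positivity) hAbd hz).1
        simpa only [hCm] using this
    have hexp : Real.exp ((1 - ε) * ‖z‖ ^ 2 / 4) ≤ Real.exp ((1 - ε) * Rε ^ 2 / 4) := by
      apply Real.exp_le_exp.2
      have : ‖z‖ ^ 2 ≤ Rε ^ 2 := pow_le_pow_left₀ (norm_nonneg _) hzR 2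
      have : 0 ≤ 1 - ε := by linarith
      nlinarith
    show w z * Real.exp ((1 - ε) * ‖z‖ ^ 2 / 4) ≤ M
    calc w z * Real.exp ((1 - ε) * ‖z‖ ^ 2 / 4) ≤ Cm ^ N * w 0 * Real.exp ((1 - ε) * Rε ^ 2 / 4) :=
          mul_le_mul hchain hexp (Real.exp_pos _).le
            (mul_nonneg (le_trans zero_le_one (one_le_pow₀ hCm1)) (hwpos 0).le)
      _ = M := by rw [hM, hw0]; ring
  -- outside the ball: maximum principle on an annulus
  by_cases hyR : ‖y‖ ≤ Rε
  · exact hball y (by simpa [Metric.mem_closedBall, dist_zero_right] using hyR)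
  push Not at hyR
  obtain ⟨R₀, hR₀⟩ := h.decay hv hvpos hv2 hN hε hMpos
  set R : ℝ := max R₀ (‖y‖ + 1) with hRdef
  have hyRlt : ‖y‖ < R := by rw [hRdef]; exact lt_of_lt_of_le (by linarith) (le_max_right _ _)
  have hRpos : 0 < R := (norm_nonneg y).trans_lt hyRlt
  set D : Set E := {z : E | Rε < ‖z‖ ∧ ‖z‖ < R} with hDdef
  have hDopen : IsOpen D :=
    (isOpen_lt continuous_const continuous_norm).inter (isOpen_lt continuous_norm continuous_const)
  have hDbdd : Bornology.IsBounded D := by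
    refine (Metric.isBounded_closedBall (x := (0 : E)) (r := R)).subset fun z hz => ?_
    rw [Metric.mem_closedBall, dist_zero_right]; exact hz.2.le
  set φ : E → ℝ := fun z => v z * gaussProfile (-(ε / 4)) z with hφdef
  have hφs : ContDiff ℝ 2 φ := (hv.of_le (by norm_cast)).mul (contDiff_gaussProfile _)
  have hvM := h.v_equation (hv.of_le (by norm_cast)) hN
  -- WMP data
  have hb : ∀ x ∈ D, ‖U x + (ε - 1 / 2) • x‖ ≤ C₀ + R := by
    intro x hx
    calc ‖U x + (ε - 1 / 2) • x‖ ≤ ‖U x‖ + ‖(ε - 1 / 2) • x‖ := norm_add_le _ _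
      _ ≤ C₀ + R := by
          rw [norm_smul, Real.norm_eq_abs, abs_of_pos (by linarith : (0:ℝ) < ε - 1 / 2)]
          have : (ε - 1 / 2) * ‖x‖ ≤ 1 * R := mul_le_mul (by linarith) hx.2.le (norm_nonneg _) zero_le_one
          linarith [h.norm_le x]
  have hV : ∀ x ∈ D, 0 ≤ ε * (1 - ε) * ‖x‖ ^ 2 / 4 - n * ε / 2 + (1 - ε) * ⟪U x, x⟫ / 2 := fun x hx =>
    h.potential_nonneg (by linarith) hε1 hx.1.le
  have hV₀ : ∀ x ∈ D, ε * (1 - ε) * ‖x‖ ^ 2 / 4 - n * ε / 2 + (1 - ε) * ⟪U x, x⟫ / 2 ≤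
      ε * (1 - ε) * R ^ 2 / 4 + (1 - ε) * C₀ / 2 := by
    intro x hx
    have h1 : ‖x‖ ^ 2 ≤ R ^ 2 := pow_le_pow_left₀ (norm_nonneg _) hx.2.le 2
    have h2 : ⟪U x, x⟫ ≤ C₀ := (abs_le.1 (h.abs_inner_le x)).2
    have h3 : 0 < ε * (1 - ε) := mul_pos (by linarith) (by linarith)
    have h4 : (0 : ℝ) ≤ n * ε / 2 := by positivity
    nlinarith
  have hsub : ∀ x ∈ D, -(Δ φ) x - fderiv ℝ φ x (U x + (ε - 1 / 2) • x) +
      (ε * (1 - ε) * ‖x‖ ^ 2 / 4 - n * ε / 2 + (1 - ε) * ⟪U x, x⟫ / 2) * φ x ≤ 0 := fun x _ =>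
    (barrier_equation (hv.of_le (by norm_cast)) hvM ε hφdef x).le
  have hbdry : ∀ x ∈ frontier D, φ x ≤ M := by
    intro x hx
    rcases frontier_annulus_subset Rε R hx with hxe | hxe
    · exact hball x (by simp [Metric.mem_closedBall, dist_zero_right, hxe])
    · exact hR₀ x (by rw [hxe]; exact le_max_left _ _)
  have hV₀0 : 0 ≤ ε * (1 - ε) * R ^ 2 / 4 + (1 - ε) * C₀ / 2 := by
    have : 0 < ε * (1 - ε) := mul_pos (by linarith) (by linarith)
    have : 0 ≤ 1 - ε := by linarith
    positivity
  have key := weak_maximum_principle hDopen hDbdd he hφs (by positivity : (0:ℝ) ≤ C₀ + R) hV₀0 hb hV hV₀ hsub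
    hMpos.le hbdry y (subset_closure ⟨hyR, hyRlt⟩)
  simpa only [hφdef] using key

/-! ### The lower Gaussian bound (Pineau–Vicol Lemma 5.5 / (5.3), via the barrier (5.9)) -/

/-- The radius beyond which the forcing `F` of (5.9) is nonnegative. [cite: PineauVicol2026, (5.9)–(5.10)] -/
def lowerRadius (n : ℕ) (C₀ ε : ℝ) : ℝ := Real.sqrt ((2 * (1 + ε) * C₀ + 2 * n * ε) / (ε * (1 + ε)))

omit [FiniteDimensional ℝ E] [MeasurableSpace E] [BorelSpace E] in
/-- `F ≥ 0` outside `B(0, R'_ε)`. [cite: PineauVicol2026, (5.9)–(5.10)] -/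
theorem DriftHyp.forcing_nonneg {U : E → E} {C₀ : ℝ} (h : DriftHyp U C₀) {ε : ℝ} (hε : 0 < ε)
    {y : E} (hy : lowerRadius (Module.finrank ℝ E) C₀ ε ≤ ‖y‖) :
    0 ≤ ε * (1 + ε) * ‖y‖ ^ 2 / 4 - (1 + ε) * ⟪U y, y⟫ / 2 - Module.finrank ℝ E * ε / 2 := by
  have hC₀ := h.nonneg
  have hin : ⟪U y, y⟫ ≤ C₀ := (abs_le.1 (h.abs_inner_le y)).2
  have hpos : 0 < ε * (1 + ε) := mul_pos hε (by linarith)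
  have hsq : (2 * (1 + ε) * C₀ + 2 * (Module.finrank ℝ E) * ε) / (ε * (1 + ε)) ≤ ‖y‖ ^ 2 := by
    have h0 : 0 ≤ (2 * (1 + ε) * C₀ + 2 * (Module.finrank ℝ E) * ε) / (ε * (1 + ε)) := by
      apply div_nonneg _ hpos.le; positivity
    calc _ = (lowerRadius (Module.finrank ℝ E) C₀ ε) ^ 2 := by rw [lowerRadius, Real.sq_sqrt h0]
      _ ≤ ‖y‖ ^ 2 := pow_le_pow_left₀ (Real.sqrt_nonneg _) hy 2
  rw [div_le_iff₀ hpos] at hsq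
  nlinarith

/-- The radius `R'_ε` of (5.10): both `V_ε ≥ 0` and `F ≥ 0` outside `B(0, R'_ε)`. [cite: PineauVicol2026, (5.10)] -/
def barrierRadius (n : ℕ) (C₀ ε : ℝ) : ℝ := max (upperRadius n C₀ ε) (lowerRadius n C₀ ε)

/-- **Lower Gaussian bound** (Pineau–Vicol (5.3), lower half; Lemma 5.5 on the whole space):
`v(0) (max C_H 1)^{-N'} e^{−ε|y|²/2} ≤ v(y) e^{−ε|y|²/4}` for all `y`, i.e.
`γ v ≥ m_ε e^{−(1+ε)|y|²/4}` with `m_ε = v(0) (max C_H 1)^{-N'}`, `N'` depending only on `ε`, `C₀`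
and the dimension. [cite: PineauVicol2026, Lemma 5.5 and (5.3)] -/
theorem DriftHyp.lower_bound {U : E → E} {C₀ : ℝ} (h : DriftHyp U C₀) {v : E → ℝ} (hv : ContDiff ℝ ∞ v)
    (hvpos : ∀ y, 0 < v y)
    (hN : ∀ y, adjN (fun z : E => (1 / 2 : ℝ) • z + U z) v y = 0) {ε : ℝ} (hε : 1 / 2 < ε) (hε1 : ε < 1)
    {e : E} (he : ‖e‖ = 1) (y : E) :
    v 0 / (max (harnackConst E) 1) ^ (⌈barrierRadius (Module.finrank ℝ E) C₀ ε *
          (C₀ + (barrierRadius (Module.finrank ℝ E) C₀ ε + 2) / 2 + 5)⌉₊ + 1) * gaussProfile (-(ε / 2)) y ≤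
      v y * gaussProfile (-(ε / 4)) y := by
  haveI : CompleteSpace E := FiniteDimensional.complete ℝ E
  set n := Module.finrank ℝ E with hn
  set R' := barrierRadius n C₀ ε with hR'
  have hR'0 : 0 ≤ R' := le_max_of_le_left (Real.sqrt_nonneg _)
  have hC₀ := h.nonneg
  set Cm := max (harnackConst E) 1 with hCm
  have hCm1 : 1 ≤ Cm := le_max_right _ _
  set N : ℕ := ⌈R' * (C₀ + (R' + 2) / 2 + 5)⌉₊ + 1 with hNdef
  have hv0 := hvpos 0
  have hCN : 1 ≤ Cm ^ N := one_le_pow₀ hCm1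
  have hCNpos : 0 < Cm ^ N := by positivity
  set m : ℝ := v 0 / Cm ^ N with hm
  have hmpos : 0 < m := div_pos hv0 hCNpos
  clear_value Cm m
  -- the `w`-equation and the chain bound on `B̄(0, R')`
  set w : E → ℝ := fun z => gaussWeight z * v z with hw
  have hws : ContDiff ℝ ∞ w := contDiff_gaussWeight.mul hv
  have hwpos : ∀ x, 0 < w x := fun x => mul_pos (gaussWeight_pos x) (hvpos x)
  have hweq : ∀ x, (Δ w) x + fderiv ℝ w x (U x + (1 / 2 : ℝ) • x) + n / 2 * w x = 0 :=
    h.w_equation (hv.of_le (by norm_cast)) hN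
  have hβ : Continuous fun x : E => U x + (1 / 2 : ℝ) • x := h.continuous.add (continuous_id.const_smul _)
  have hw0 : w 0 = v 0 := by simp [hw, gaussWeight]
  have hballw : ∀ z ∈ Metric.closedBall (0 : E) R', m ≤ w z := by
    intro z hz
    have hzR : ‖z‖ ≤ R' := by simpa [Metric.mem_closedBall, dist_zero_right] using hz
    rcases hR'0.eq_or_lt with h0 | hRpos
    · have : z = 0 := by rw [← norm_le_zero_iff]; exact hzR.trans_eq h0.symm
      subst this
      rw [hm, hw0, div_le_iff₀ hCNpos]
      nlinarith
    · have hAbd : ∀ x ∈ Metric.ball (0 : E) (R' + 2), ‖U x + (1 / 2 : ℝ) • x‖ ≤ C₀ + (R' + 2) / 2 := by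
        intro x hx
        rw [Metric.mem_ball, dist_zero_right] at hx
        calc ‖U x + (1 / 2 : ℝ) • x‖ ≤ ‖U x‖ + ‖(1 / 2 : ℝ) • x‖ := norm_add_le _ _
          _ ≤ C₀ + (R' + 2) / 2 := by
              rw [norm_smul, Real.norm_eq_abs, abs_of_pos (by norm_num : (0:ℝ) < 1 / 2)]
              exact add_le_add (h.norm_le x) (by linarith)
      have := (harnack_chain hws hwpos hβ (by positivity : (0 : ℝ) ≤ n / 2) hweq hRpos (by positivity) hAbd hz).2
      rw [← hCm] at this
      rw [hm, hw0.symm, div_le_iff₀ hCNpos]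
      linarith
  set φ : E → ℝ := fun z => v z * gaussProfile (-(ε / 4)) z with hφdef
  have hφs : ContDiff ℝ 2 φ := (hv.of_le (by norm_cast)).mul (contDiff_gaussProfile _)
  have hφpos : ∀ z, 0 < φ z := fun z => mul_pos (hvpos z) (Real.exp_pos _)
  have hg1 : ∀ z : E, gaussProfile (-(ε / 2)) z ≤ 1 := fun z => by
    rw [gaussProfile]; apply Real.exp_le_one_iff.2; nlinarith [sq_nonneg ‖z‖]
  have hgpos : ∀ z : E, 0 < gaussProfile (-(ε / 2)) z := fun z => Real.exp_pos _
  have hball : ∀ z ∈ Metric.closedBall (0 : E) R', m * gaussProfile (-(ε / 2)) z ≤ φ z := by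
    intro z hz
    have h1 : m * gaussProfile (-(ε / 2)) z ≤ m := by nlinarith [hg1 z, hgpos z]
    have h2 : w z ≤ φ z := by
      show w z ≤ v z * gaussProfile (-(ε / 4)) z
      rw [phiEps_eq]
      have : 1 ≤ Real.exp ((1 - ε) * ‖z‖ ^ 2 / 4) := Real.one_le_exp (by
        have : 0 ≤ 1 - ε := by linarith
        positivity)
      show w z ≤ w z * Real.exp ((1 - ε) * ‖z‖ ^ 2 / 4)
      nlinarith [hwpos z]
    linarith [hballw z hz]
  -- suppose the bound fails at `y`
  show m * gaussProfile (-(ε / 2)) y ≤ φ y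
  by_contra hlt
  push Not at hlt
  have hyR : R' < ‖y‖ := by
    by_contra hle
    push Not at hle
    exact absurd (hball y (by simpa [Metric.mem_closedBall, dist_zero_right] using hle)) (not_le.2 hlt)
  set δ : ℝ := m * gaussProfile (-(ε / 2)) y - φ y with hδ
  have hδpos : 0 < δ := by rw [hδ]; linarith
  clear_value δ
  obtain ⟨R₂, hR₂0, hR₂⟩ := exists_exp_quadratic_le (a := ε / 2) (by linarith) 0 0 (η := δ / (2 * m)) (by positivity)
  set R : ℝ := max R₂ (‖y‖ + 1) with hRdef
  have hyRlt : ‖y‖ < R := lt_of_lt_of_le (by linarith) (le_max_right _ _)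
  have hRpos : 0 < R := (norm_nonneg y).trans_lt hyRlt
  have hR₂R : R₂ ≤ R := le_max_left _ _
  clear_value R
  set M₀ : ℝ := m * Real.exp (-(ε / 2) * R ^ 2) with hM₀
  have hM₀0 : 0 ≤ M₀ := by rw [hM₀]; exact mul_nonneg hmpos.le (Real.exp_pos _).le
  clear_value M₀
  have hM₀δ : M₀ ≤ δ / 2 := by
    have := hR₂ R hR₂R
    simp only [zero_mul, add_zero] at this
    rw [hM₀]
    calc m * Real.exp (-(ε / 2) * R ^ 2) ≤ m * (δ / (2 * m)) := mul_le_mul_of_nonneg_left this hmpos.le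
      _ = δ / 2 := by field_simp
  -- the annulus and the WMP data
  set D : Set E := {z : E | R' < ‖z‖ ∧ ‖z‖ < R} with hDdef
  have hDopen : IsOpen D :=
    (isOpen_lt continuous_const continuous_norm).inter (isOpen_lt continuous_norm continuous_const)
  have hDbdd : Bornology.IsBounded D := by
    refine (Metric.isBounded_closedBall (x := (0 : E)) (r := R)).subset fun z hz => ?_
    rw [Metric.mem_closedBall, dist_zero_right]; exact hz.2.le
  have hvM := h.v_equation (hv.of_le (by norm_cast)) hN
  set ψ : E → ℝ := m • gaussProfile (E := E) (-(ε / 2)) - φ with hψdef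
  clear_value ψ
  have hψapp : ∀ z, ψ z = m * gaussProfile (-(ε / 2)) z - φ z := fun z => by simp [hψdef]
  have hgs : ContDiff ℝ 2 (gaussProfile (E := E) (-(ε / 2))) := contDiff_gaussProfile _
  have hmgs : ContDiff ℝ 2 (m • gaussProfile (E := E) (-(ε / 2))) := by exact hgs.const_smul m
  have hψs : ContDiff ℝ 2 ψ := by rw [hψdef]; exact hmgs.sub hφs
  have hb : ∀ x ∈ D, ‖U x + (ε - 1 / 2) • x‖ ≤ C₀ + R := by
    intro x hx
    calc ‖U x + (ε - 1 / 2) • x‖ ≤ ‖U x‖ + ‖(ε - 1 / 2) • x‖ := norm_add_le _ _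
      _ ≤ C₀ + R := by
          rw [norm_smul, Real.norm_eq_abs, abs_of_pos (by linarith : (0:ℝ) < ε - 1 / 2)]
          have : (ε - 1 / 2) * ‖x‖ ≤ 1 * R := mul_le_mul (by linarith) hx.2.le (norm_nonneg _) zero_le_one
          linarith [h.norm_le x]
  have hR'u : upperRadius n C₀ ε ≤ R' := le_max_left _ _
  have hR'l : lowerRadius n C₀ ε ≤ R' := le_max_right _ _
  have hV : ∀ x ∈ D, 0 ≤ ε * (1 - ε) * ‖x‖ ^ 2 / 4 - n * ε / 2 + (1 - ε) * ⟪U x, x⟫ / 2 := fun x hx =>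
    h.potential_nonneg (by linarith) hε1 (hR'u.trans hx.1.le)
  have hV₀ : ∀ x ∈ D, ε * (1 - ε) * ‖x‖ ^ 2 / 4 - n * ε / 2 + (1 - ε) * ⟪U x, x⟫ / 2 ≤
      ε * (1 - ε) * R ^ 2 / 4 + (1 - ε) * C₀ / 2 := by
    intro x hx
    have h1 : ‖x‖ ^ 2 ≤ R ^ 2 := pow_le_pow_left₀ (norm_nonneg _) hx.2.le 2
    have h2 : ⟪U x, x⟫ ≤ C₀ := (abs_le.1 (h.abs_inner_le x)).2
    have h3 : 0 < ε * (1 - ε) := mul_pos (by linarith) (by linarith)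
    have h4 : (0 : ℝ) ≤ n * ε / 2 := by positivity
    nlinarith
  have hV₀0 : 0 ≤ ε * (1 - ε) * R ^ 2 / 4 + (1 - ε) * C₀ / 2 := by
    have : 0 < ε * (1 - ε) := mul_pos (by linarith) (by linarith)
    have : 0 ≤ 1 - ε := by linarith
    positivity
  have hsub : ∀ x ∈ D, -(Δ ψ) x - fderiv ℝ ψ x (U x + (ε - 1 / 2) • x) +
      (ε * (1 - ε) * ‖x‖ ^ 2 / 4 - n * ε / 2 + (1 - ε) * ⟪U x, x⟫ / 2) * ψ x ≤ 0 := by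
    intro x hx
    have hF := h.forcing_nonneg (by linarith : (0:ℝ) < ε) (hR'l.trans hx.1.le)
    have e1 := barrier_gaussian U ε x
    have e2 := barrier_equation (hv.of_le (by norm_cast)) hvM ε hφdef x
    have hΔ : (Δ ψ) x = m * (Δ (gaussProfile (E := E) (-(ε / 2)))) x - (Δ φ) x := by
      rw [hψdef, ContDiffAt.laplacian_sub (f₁ := m • gaussProfile (E := E) (-(ε / 2))) hmgs.contDiffAt hφs.contDiffAt,
        laplacian_smul _ hgs.contDiffAt, smul_eq_mul]
    have hmgd : DifferentiableAt ℝ (m • gaussProfile (E := E) (-(ε / 2))) x := hmgs.differentiable (by norm_num) x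
    have hDψ : fderiv ℝ ψ x = m • fderiv ℝ (gaussProfile (E := E) (-(ε / 2))) x - fderiv ℝ φ x := by
      rw [hψdef, fderiv_sub hmgd (hφs.differentiable (by norm_num) x),
        fderiv_const_smul (hgs.differentiable (by norm_num) x)]
    rw [hΔ, hDψ, hψapp x]
    simp only [_root_.sub_apply, FunLike.coe_smul, Pi.smul_apply, smul_eq_mul]
    have hg0 := (hgpos x).le
    have key : -(m * (Δ (gaussProfile (E := E) (-(ε / 2)))) x - (Δ φ) x) -
        (m * fderiv ℝ (gaussProfile (E := E) (-(ε / 2))) x (U x + (ε - 1 / 2) • x) - fderiv ℝ φ x (U x + (ε - 1 / 2) • x)) +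
        (ε * (1 - ε) * ‖x‖ ^ 2 / 4 - n * ε / 2 + (1 - ε) * ⟪U x, x⟫ / 2) * (m * gaussProfile (-(ε / 2)) x - φ x) =
        m * (-(gaussProfile (-(ε / 2)) x * (ε * (1 + ε) * ‖x‖ ^ 2 / 4 - (1 + ε) * ⟪U x, x⟫ / 2 - n * ε / 2))) - 0 := by
      rw [← e1, ← e2]; ring
    rw [key, sub_zero, mul_neg, neg_nonpos]
    exact mul_nonneg hmpos.le (mul_nonneg hg0 hF)
  have hbdry : ∀ x ∈ frontier D, ψ x ≤ M₀ := by
    intro x hx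
    rw [hψapp]
    rcases frontier_annulus_subset R' R hx with hxe | hxe
    · have := hball x (by simp [Metric.mem_closedBall, dist_zero_right, hxe])
      linarith
    · have : m * gaussProfile (-(ε / 2)) x = M₀ := by rw [hM₀, gaussProfile, hxe]
      linarith [hφpos x]
  have key := weak_maximum_principle hDopen hDbdd he hψs (by positivity : (0:ℝ) ≤ C₀ + R) hV₀0 hb hV hV₀ hsub
    hM₀0 hbdry y (subset_closure ⟨hyR, hyRlt⟩)
  rw [hψapp] at key
  linarith

/-! ### Assembly: Proposition 5.1′ (the positive weight with two-sided Gaussian bounds) -/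

omit [MeasurableSpace E] [BorelSpace E] in
/-- `N (c g) = c N g`. [folklore] -/
theorem adjN_const_mul {X₀ : E → E} {g : E → ℝ} (hg : ContDiff ℝ 2 g) (hX₀ : ContDiff ℝ 1 X₀) (c : ℝ) (y : E) :
    adjN X₀ (fun z => c * g z) y = c * adjN X₀ g y := by
  have e := adjN_comp_eq (ψ := fun t : ℝ => c * t) (contDiff_const.mul contDiff_id) hg hX₀ y
  have hc : ((fun t : ℝ => c * t) ∘ g) = fun z => c * g z := rfl
  rw [hc] at e
  rw [e]
  have d1 : deriv (fun t : ℝ => c * t) = fun _ => c := by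
    funext t
    have : (fun t : ℝ => c * t) = fun t => c * id t := rfl
    rw [this, deriv_const_mul c differentiableAt_id, deriv_id, mul_one]
  simp only [d1, deriv_const']
  ring

omit [MeasurableSpace E] [BorelSpace E] in
/-- `∇(c g) = c ∇g`. [folklore] -/
theorem gradient_const_mul' {g : E → ℝ} (hg : Differentiable ℝ g) (c : ℝ) :
    gradient (fun z => c * g z) = fun y => c • gradient g y := by
  haveI : CompleteSpace E := FiniteDimensional.complete ℝ E
  funext y
  apply ext_inner_right ℝ
  intro w
  rw [inner_gradient_left, real_inner_smul_left, inner_gradient_left, fderiv_const_mul (hg y) c]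
  rfl

variable (E) in
/-- The constant `M_ε` of the upper Gaussian bound (5.3) (for the weight normalised by `v(0) = 1`);
depends only on `ε`, `C₀` and the dimension. [cite: PineauVicol2026, Proposition 5.1, (5.3)] -/
def weightUpperConst (C₀ ε : ℝ) : ℝ :=
  (max (harnackConst E) 1) ^ (⌈upperRadius (Module.finrank ℝ E) C₀ ε *
      (C₀ + (upperRadius (Module.finrank ℝ E) C₀ ε + 2) / 2 + 5)⌉₊ + 1) *
    Real.exp ((1 - ε) * (upperRadius (Module.finrank ℝ E) C₀ ε) ^ 2 / 4)

variable (E) in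
/-- The constant `m_ε` of the lower Gaussian bound (5.3) (for the weight normalised by `v(0) = 1`);
depends only on `ε`, `C₀` and the dimension. [cite: PineauVicol2026, Proposition 5.1, (5.3)] -/
def weightLowerConst (C₀ ε : ℝ) : ℝ :=
  1 / (max (harnackConst E) 1) ^ (⌈barrierRadius (Module.finrank ℝ E) C₀ ε *
      (C₀ + (barrierRadius (Module.finrank ℝ E) C₀ ε + 2) / 2 + 5)⌉₊ + 1)

/-- `M_ε > 0`. [folklore] -/
theorem weightUpperConst_pos (C₀ ε : ℝ) : 0 < weightUpperConst E C₀ ε := by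
  unfold weightUpperConst
  have : 0 < max (harnackConst E) 1 := lt_of_lt_of_le one_pos (le_max_right _ _)
  positivity

/-- `m_ε > 0`. [folklore] -/
theorem weightLowerConst_pos (C₀ ε : ℝ) : 0 < weightLowerConst E C₀ ε := by
  unfold weightLowerConst
  have : 0 < max (harnackConst E) 1 := lt_of_lt_of_le one_pos (le_max_right _ _)
  positivity

section EuclideanAssembly

variable {n : ℕ} {U : EuclideanSpace ℝ (Fin (n + 1)) → EuclideanSpace ℝ (Fin (n + 1))} {C₀ : ℝ}

/-- **Proposition 5.1′ (Pineau–Vicol Prop. 5.1, whole-space version, `ε ∈ (½,1)`).** For a smooth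
divergence-free drift `U` on `ℝ^{n+1}` with `|U| ≤ C₀`, `|U·y| ≤ C₀`, there is a smooth `v > 0`,
`v(0) = 1`, `v, ∇v ∈ L²(γ)`, such that the weight `w = γ v` (`γ = e^{−|y|²/4}`) solves
`L*w = Δw + div(w (U + ½y)) = 0` and obeys the two-sided Gaussian bounds
`m_ε e^{−(1+ε)|y|²/4} ≤ w(y) ≤ M_ε e^{−(1−ε)|y|²/4}` with `m_ε, M_ε > 0` depending only on
`ε`, `C₀`, `n`. (Proof: Lax–Milgram + Fredholm on `H¹(γ)`, Hörmander hypoellipticity, a regularised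
Kato inequality and Hopf's lemma for positivity, Lieberman's Harnack inequality and comparison with
the barriers (5.6)–(5.9) for the bounds — replacing the Kreĭn–Rutman construction of the source.)
[cite: PineauVicol2026, Proposition 5.1, (5.2)–(5.3)] -/
theorem DriftHyp.exists_weight (h : DriftHyp U C₀) {ε : ℝ} (hε : 1 / 2 < ε) (hε1 : ε < 1) :
    ∃ v : EuclideanSpace ℝ (Fin (n + 1)) → ℝ, ContDiff ℝ ∞ v ∧ (∀ y, 0 < v y) ∧ v 0 = 1 ∧
      MemLp v 2 (gaussMeasure (E := EuclideanSpace ℝ (Fin (n + 1)))) ∧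
      MemLp (gradient v) 2 (gaussMeasure (E := EuclideanSpace ℝ (Fin (n + 1)))) ∧
      (∀ y, (Δ (fun z => gaussWeight z * v z)) y +
        VectorCalculus.divergence (fun z => (gaussWeight z * v z) • (U z + (1 / 2 : ℝ) • z)) y = 0) ∧
      (∀ y, weightLowerConst (EuclideanSpace ℝ (Fin (n + 1))) C₀ ε * Real.exp (-(1 + ε) * ‖y‖ ^ 2 / 4) ≤
        gaussWeight y * v y) ∧
      (∀ y, gaussWeight y * v y ≤
        weightUpperConst (EuclideanSpace ℝ (Fin (n + 1))) C₀ ε * Real.exp (-(1 - ε) * ‖y‖ ^ 2 / 4)) := by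
  obtain ⟨v, hv, hv2, hG2, hvpos, hN⟩ := h.exists_pos_solution
  have hv0 := hvpos 0
  set c : ℝ := (v 0)⁻¹ with hc
  have hcpos : 0 < c := inv_pos.2 hv0
  have hX₀1 : ContDiff ℝ 1 (fun z : EuclideanSpace ℝ (Fin (n + 1)) => (1 / 2 : ℝ) • z + U z) :=
    (contDiff_id.const_smul (1 / 2 : ℝ)).add h.contDiff_one
  set v' : EuclideanSpace ℝ (Fin (n + 1)) → ℝ := fun y => c * v y with hv'
  have hv's : ContDiff ℝ ∞ v' := contDiff_const.mul hv
  have hv'pos : ∀ y, 0 < v' y := fun y => mul_pos hcpos (hvpos y)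
  have hv'0 : v' 0 = 1 := by simp [hv', hc, hv0.ne']
  have hv'2 : MemLp v' 2 (gaussMeasure (E := EuclideanSpace ℝ (Fin (n + 1)))) := hv2.const_mul c
  have hG'2 : MemLp (gradient v') 2 (gaussMeasure (E := EuclideanSpace ℝ (Fin (n + 1)))) := by
    rw [hv', gradient_const_mul' (hv.differentiable (by simp)) c]
    exact hG2.const_smul c
  have hN' : ∀ y, adjN (fun z : EuclideanSpace ℝ (Fin (n + 1)) => (1 / 2 : ℝ) • z + U z) v' y = 0 := by
    intro y
    rw [hv', adjN_const_mul (hv.of_le (by norm_cast)) hX₀1, hN y, mul_zero]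
  have he : ‖(EuclideanSpace.single (0 : Fin (n + 1)) (1 : ℝ))‖ = 1 := by
    rw [EuclideanSpace.single, PiLp.norm_single, norm_one]
  refine ⟨v', hv's, hv'pos, hv'0, hv'2, hG'2, fun y => ?_, fun y => ?_, fun y => ?_⟩
  · have := hN' y
    unfold adjN at this
    simpa only [add_comm (U _) ((1 / 2 : ℝ) • _)] using this
  · have hl := h.lower_bound hv's hv'pos hN' hε hε1 he y
    rw [hv'0, phiEps_eq] at hl
    have hexp : Real.exp (-(1 + ε) * ‖y‖ ^ 2 / 4) =
        gaussProfile (-(ε / 2)) y * Real.exp (-((1 - ε) * ‖y‖ ^ 2 / 4)) := by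
      rw [gaussProfile, ← Real.exp_add]; congr 1; ring
    have hpos : 0 < Real.exp (-((1 - ε) * ‖y‖ ^ 2 / 4)) := Real.exp_pos _
    have := mul_le_mul_of_nonneg_right hl hpos.le
    rw [mul_assoc (gaussWeight y * v' y), ← Real.exp_add, add_neg_cancel, Real.exp_zero, mul_one] at this
    rw [weightLowerConst, hexp, ← mul_assoc]
    exact this
  · have hu := h.upper_bound hv's hv'pos hv'2 hN' hε hε1 he y
    rw [hv'0, mul_one, phiEps_eq] at hu
    have hexp : Real.exp (-(1 - ε) * ‖y‖ ^ 2 / 4) = Real.exp (-((1 - ε) * ‖y‖ ^ 2 / 4)) := by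
      congr 1; ring
    have hpos : 0 < Real.exp (-((1 - ε) * ‖y‖ ^ 2 / 4)) := Real.exp_pos _
    have := mul_le_mul_of_nonneg_right hu hpos.le
    rw [mul_assoc (gaussWeight y * v' y), ← Real.exp_add, add_neg_cancel, Real.exp_zero, mul_one] at this
    rw [weightUpperConst, hexp]
    exact this

end EuclideanAssembly

end PineauVicol2026

end Literature.Analysis.FluidPDE
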